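import Summits.KontsevichZagierPeriods.KontsevichZagierPeriods.Theses.SymplecticScissors
import Summits.KontsevichZagierPeriods.KontsevichZagierPeriods.Theorems.SymplecticScissorsVolumeFormOffPlaneDimLeOne
import Summits.KontsevichZagierPeriods.KontsevichZagierPeriods.Theorems.SymplecticScissorsVolumeFormOffPlaneLogBoxValue
import Summits.KontsevichZagierPeriods.KontsevichZagierPeriods.Theorems.SymplecticScissorsVolumeFormOffPlaneLogBoxCut
import Summits.KontsevichZagierPeriods.KontsevichZagierPeriods.Theorems.SymplecticScissorsVolumeFormOffPlaneRankTwoLogRatio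
import Summits.KontsevichZagierPeriods.KontsevichZagierPeriods.Theorems.SymplecticScissorsVolumeFormOffPlaneLogBoxLinear
import Summits.KontsevichZagierPeriods.KontsevichZagierPeriods.Theorems.SymplecticScissorsVolumeFormOffPlaneToricF
import Summits.KontsevichZagierPeriods.KontsevichZagierPeriods.Theorems.SymplecticScissorsVolumeFormOffPlaneToricG
import Summits.KontsevichZagierPeriods.KontsevichZagierPeriods.Theorems.SymplecticScissorsVolumeFormOffPlaneToricH
import Summits.KontsevichZagierPeriods.KontsevichZagierPeriods.Theorems.SymplecticScissorsVolumeFormOffPlaneToricE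
import Summits.KontsevichZagierPeriods.KontsevichZagierPeriods.Theorems.SymplecticScissorsVolumeFormOffPlaneTriExists
import Summits.KontsevichZagierPeriods.KontsevichZagierPeriods.Theorems.SymplecticScissorsVolumeFormOffPlanePowerMove
import Summits.KontsevichZagierPeriods.KontsevichZagierPeriods.Theorems.SymplecticScissorsVolumeFormOffPlaneInversionMove
import Summits.KontsevichZagierPeriods.KontsevichZagierPeriods.Theorems.SymplecticScissorsVolumeFormOffPlaneSquareSplit
import Summits.KontsevichZagierPeriods.KontsevichZagierPeriods.Theorems.SymplecticScissorsVolumeFormOffPlaneMixedSector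
import Summits.KontsevichZagierPeriods.KontsevichZagierPeriods.Theorems.SymplecticScissorsVolumeFormOffPlaneTriToBox
import Summits.KontsevichZagierPeriods.KontsevichZagierPeriods.Theorems.SymplecticScissorsVolumeFormOffPlaneSimplexExists
import Summits.KontsevichZagierPeriods.KontsevichZagierPeriods.Theorems.SymplecticScissorsVolumeFormOffPlaneOrderCellPerm
import Summits.KontsevichZagierPeriods.KontsevichZagierPeriods.Theorems.SymplecticScissorsVolumeFormOffPlaneCubeDecomposition
import Summits.KontsevichZagierPeriods.KontsevichZagierPeriods.Theorems.SymplecticScissorsVolumeFormOffPlaneCumprodMove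
import Summits.KontsevichZagierPeriods.KontsevichZagierPeriods.Theorems.SymplecticScissorsVolumeFormOffPlaneSimplexSector
import Summits.KontsevichZagierPeriods.KontsevichZagierPeriods.Theorems.SymplecticScissorsVolumeFormOffPlaneSimplexToBox
import Summits.KontsevichZagierPeriods.KontsevichZagierPeriods.Theorems.SymplecticScissorsVolumeFormOffPlaneUnionSplit
import Summits.KontsevichZagierPeriods.KontsevichZagierPeriods.Theorems.SymplecticScissorsVolumeFormOffPlaneBinomialSector
import Summits.KontsevichZagierPeriods.KontsevichZagierPeriods.Theorems.SymplecticScissorsVolumeFormOffPlaneSimplexPairs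
import Summits.KontsevichZagierPeriods.KontsevichZagierPeriods.Theorems.SymplecticScissorsVolumeFormOffPlanePolygonPairs
import Summits.KontsevichZagierPeriods.KontsevichZagierPeriods.Theorems.SymplecticScissorsVolumeFormOffPlaneMatrixPowerMove
import Summits.KontsevichZagierPeriods.KontsevichZagierPeriods.Theorems.SymplecticScissorsVolumeFormOffPlaneBinomialCellToBox
import Summits.KontsevichZagierPeriods.KontsevichZagierPeriods.Theorems.SymplecticScissorsVolumeFormOffPlaneScissors
import Summits.KontsevichZagierPeriods.KontsevichZagierPeriods.Theorems.SymplecticScissorsVolumeFormOffPlaneWeightedOfFamilies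
import Summits.KontsevichZagierPeriods.KontsevichZagierPeriods.Theorems.SymplecticScissorsVolumeFormOffPlanePairsOfDecomposition
import Summits.KontsevichZagierPeriods.KontsevichZagierPeriods.Theorems.SymplecticScissorsVolumeFormOffPlaneCornerCut
import Summits.KontsevichZagierPeriods.KontsevichZagierPeriods.Theorems.SymplecticScissorsVolumeFormOffPlaneTorsionClosure
import Summits.KontsevichZagierPeriods.KontsevichZagierPeriods.Theorems.SymplecticScissorsVolumeFormOffPlaneSlackMerge
import Summits.KontsevichZagierPeriods.KontsevichZagierPeriods.Theorems.SymplecticScissorsVolumeFormOffPlaneBinomialCertificate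
import Summits.KontsevichZagierPeriods.KontsevichZagierPeriods.Theorems.SymplecticScissorsVolumeFormOffPlaneProductCertificate
import Summits.KontsevichZagierPeriods.KontsevichZagierPeriods.Theorems.SymplecticScissorsVolumeFormOffPlaneCutBoxDecomposition
import Summits.KontsevichZagierPeriods.KontsevichZagierPeriods.Theorems.SymplecticScissorsVolumeFormOffPlaneCornerCertificate
import Summits.KontsevichZagierPeriods.KontsevichZagierPeriods.Theorems.SymplecticScissorsVolumeFormOffPlaneParallelepipedCertificate
import Summits.KontsevichZagierPeriods.KontsevichZagierPeriods.Theorems.SymplecticScissorsVolumeFormOffPlaneCertifiedPairs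
import Summits.KontsevichZagierPeriods.KontsevichZagierPeriods.Theorems.SymplecticScissorsVolumeFormOffPlaneBevelledBoxPairs
import Summits.KontsevichZagierPeriods.KontsevichZagierPeriods.Theorems.SymplecticScissorsVolumeFormOffPlaneIndicatorInclusionExclusion
import Summits.KontsevichZagierPeriods.KontsevichZagierPeriods.Theorems.SymplecticScissorsVolumeFormOffPlaneBoxUnionPairs
import Summits.KontsevichZagierPeriods.KontsevichZagierPeriods.Theorems.SymplecticScissorsVolumeFormOffPlaneMonomialCertificates
import Summits.KontsevichZagierPeriods.KontsevichZagierPeriods.Theorems.SymplecticScissorsVolumeFormOffPlaneCommensurablePairs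
import Summits.KontsevichZagierPeriods.KontsevichZagierPeriods.Theorems.SymplecticScissorsVolumeFormOffPlaneAffineOrbitPairs
import Summits.KontsevichZagierPeriods.KontsevichZagierPeriods.Theorems.SymplecticScissorsVolumeFormOffPlaneAlgebraicBoxUnionPairs
import Summits.KontsevichZagierPeriods.KontsevichZagierPeriods.Theorems.SymplecticScissorsVolumeFormOffPlaneEuclideanCornerCut
import Summits.KontsevichZagierPeriods.KontsevichZagierPeriods.Theorems.SymplecticScissorsVolumeFormOffPlaneAlgebraicBevelledBoxPairs
import Summits.KontsevichZagierPeriods.KontsevichZagierPeriods.Theorems.SymplecticScissorsVolumeFormOffPlaneEllipsoidPairs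
import Literature.NumberTheory.Transcendental.KZRulesAssociator
import Literature.NumberTheory.Transcendental.KZBallPeeling


/-!
# Crux `VolumeFormOffPlane` (stmt-KontsevichZagierPeriods-14935) — line `Sketch`
(card `log-polytope-hilbert-three`): crux-concluding skeleton, v7 (continuation lead c3)

The crux is the frame `VolumeForm` (stmt-3814) restricted to dimensions `N ≠ 2`: two
integrand-`1` representations of dimension `N ≠ 2` with equal value are KZ-equivalent. It is
summit-equivalent for `N ≥ 3` (`Theorems/VolumeFormOffPlane/Negative/Core.lean`:
`VolumeFormOffPlane ↔ VolumeForm ↔ KontsevichZagierPeriods`), so no line closes it outright; the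
skeleton isolates what the line PROVES unconditionally and names what it concedes.

v2 (opening lead, all landed): `stub_dimLeOne` (`N ≤ 1`), and the RANK-TWO TORIC BOX SECTOR in
every dimension (`stub_logBoxValue`, `stub_logBoxCut`, `stub_logBoxLinear`, `stub_rankTwoLogRatio`,
`stub_toricAssembly`; extras F/G/H: pair form, rational exponents, real-algebraic position).

v3 (this continuation) carves the next sector out of the conceded residual — the card's
"divided-power dissection" in dimension `3`, i.e. the RANK-TWO TORIC POLYGON SECTOR: cells of
`{x > 0, y > 0} × {0 < z < 1/(xy)}` cut out by monomial inequalities `x^i y^j ≶ c`. In logarithmic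
coordinates `u = log x, v = log y` these are polygons with rational edge normals, the moves of the
KZ calculus realise the affine group `GL₂(ℚ) ⋉ Λ²` up to integer Jacobians (monomial maps
`(x, y) ↦ (x^i, y^j)`, inversions `x ↦ A/x`, diagonal scalings) together with cuts along binomial
walls, and `FormalRep ⧸ relations` is torsion-free (tree). New stubs:

* `stub_triExists` — integrand-`1` representations exist on the three triangle shapes;
* `stub_powerMove` — the monomial map `(x, y, z) ↦ (x^i, y^j, z·xy/(x^i y^j))` on the open
  quadrant is ONE rule-(2) move with `|det| = i·j`: `[image] − (i·j) • [source] ∈ relations`;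
* `stub_inversionMove` — the inversions `(x, y, z) ↦ (A/x, y, z·x²/A)` and
  `(x, y, z) ↦ (x, A/y, z·y²/A)` (`A > 0` real algebraic) are rule-(2) moves with `|det| = 1`;
* `stub_squareSplit` — the log-square `{1 < x, y < g}` splits along the hyperbola `xy = g` into the
  log-triangle `{x, y > 1, xy < g}` and its half-turn image (rule (1a), null wall);
* `stub_triToBox` (lead) — HILBERT III FOR LOG-TRIANGLES: the log-triangle
  `{x > a, y > b, x^i y^j < c}` is KZ-equivalent to the log-box over `(a, b)` with edge ratios
  `g = c/(aⁱbʲ)` and `g^{1/(2ij)}` (normalise, power move, two inversions, split, box stacking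
  `toric_pow`, torsion-freeness);
* `stub_mixedSector` — bookkeeping: mixed finite families of log-boxes (real-algebraic position,
  edge ratios in `α^ℚ β^ℚ`) and log-triangles (`c/(aⁱbʲ) ∈ α^ℚ β^ℚ`) with equal total volume are
  KZ-equivalent as formal sums, from `stub_triToBox` and the landed position-form box sector;
* `stub_frameHighResidual` — the REST of `N ≥ 3` given both sectors: summit-strength, CONCEDED.

`VolumeFormOffPlane_of` concludes the crux BY NAME from the stubs (cases `N ≤ 1` / `N ≥ 3`).
All stub signatures are definition-free (tree vocabulary only).

v6 (continuation lead c2) adds the SIGNED SCISSORS layer: `stub_scissors` (an a.e. identity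
`Σ εᵢ·1_{ρᵢ.domain} = 0` between integrand-`1` representations forces `Σ εᵢ•[ρᵢ] ∈ relations`),
`stub_weightedOfFamilies` (two-sided family form ⇒ `ℤ`-weighted families),
`stub_pairsOfDecomposition` (pairs of representations with a.e. signed cell decompositions and
equal value are KZ-equivalent) — fed with the landed binomial sector this covers every finite
union of `Λ`-rational polytopes in every dimension modulo a supplied signed decomposition into
rational simplices (Lawrence–Varchenko) —, `stub_cornerCut` (the proved decomposition of a log-box
cut by one binomial wall into its `2ⁿ` corner simplices) and `stub_slackMerge` (the toric encoding
is multiplicative: `[cell_C]·[cell_D] ≡ [cell_{C×D}]`) and `stub_torsionClosure` (the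
`ℤ`-weighted property of a class passes to every representation with a certificate
`d • [ρ] ≡ Σ wⱼ • [σⱼ]` over the class, by torsion-freeness).

STATUS (continuation lead c2, 2026-08-17): v2–v5 LANDED; v6: stub_scissors p134898, stub_weightedOfFamilies
p134218, stub_pairsOfDecomposition p134117, stub_cornerCut p134232, stub_torsionClosure p134236 LANDED and
imported; stub_slackMerge p135137 LANDED; compositions `weightedBoxes`, `certifiedPairs` proved below;
wave 2 LANDED: stub_binomialCertificate p135528, stub_productCertificate p135758, stub_cutBoxDecomposition p135487,
stub_cornerCertificate p135544, stub_parallelepipedCertificate p135608 (imported);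
compositions weightedBoxes/certifiedPairs/certifiedPairsFintype/simplexDecompositionPairs LANDED p135886; wave 3
LANDED: stub_bevelledBoxPairs p136212, stub_indicatorInclusionExclusion p136075,
stub_boxUnionPairs p136363, stub_monomialCertificates p136154 (imported); only the conceded residual is open.
Wave 4 + lead (beyond the torus): commensurablePairs p136455, affineOrbitPairs/algebraicSimplexPairs p136689,
stub_algebraicBoxUnionPairs p137071, stub_euclideanCornerCut p136821, stub_algebraicBevelledBoxPairs p137157,
ellipsoidPairs p137278 — the Euclidean polytope/ellipsoid sector in every dimension.
the conceded residual `stub_frameHighResidual` (summit-equivalent) is re-fed with the v6 layer.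

v7 (continuation lead c3, 2026-08-17) adds the TWO-PERIODS layer: K-cells (`[ρ] ≡ [pt, v]`, `v ∈ ℚ̄`:
boxes, algebraic simplices by Dirichlet peeling, polynomial subgraphs over rational boxes by rule (3)
and the cube polynomial kernel) have the ℤ-weighted property (`stub_pointCellsWeighted`); the affine
orbit of ONE body of TRANSCENDENTAL volume (balls `B_d`, `d ≥ 2`, Lindemann — proved in the tree —
`stub_ballVolumeTranscendental`) mixes with them by PERIOD SPLITTING (`stub_periodSplit`); stubs
`stub_subgraphToBase` (one Newton–Leibniz move), `stub_simplexCell`, `stub_polynomialBoxCell` (lead).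
STATUS v7.0: six stubs open (wave 1), residual conceded and re-fed with the v7 layer.
-/

noncomputable section

open MeasureTheory Set
open Literature.NumberTheory.Transcendental

namespace Summit.KontsevichZagierPeriods.SymplecticScissors.LogPolytope

/-! ## Stubs (v2 stubs `stub_dimLeOne`, `stub_logBoxValue`, `stub_logBoxCut`, `stub_logBoxLinear`,
`stub_rankTwoLogRatio`, `stub_toricAssembly`: LANDED, imported) -/

-- stub_triExists: LANDED p130097 (imported).

-- stub_powerMove: LANDED p130491 (imported).

-- stub_inversionMove: LANDED p130436 (imported).

-- stub_squareSplit: LANDED p130233 (imported).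

-- stub_triToBox: LANDED p130744 (imported).

-- stub_mixedSector: LANDED p130412 (imported).

/-! ### v4: the divided power in every dimension (log-simplices)

Box-dimension `n` (total dimension `n + 1`), box coordinates `x_ι = p (Fin.castSucc ι)`, slack
`z = p (Fin.last n)` with `0 < z ∧ z · ∏ x_ι < 1`. Shapes: the CUBE `{1 < x_ι < g}`; the ORDER
CELLS `O_σ(g) = cube ∩ {x_{σ 0} < x_{σ 1} < ⋯ < x_{σ (n-1)}}` (`σ` a permutation; `O_id` for
`σ = 1`); the LOG-SIMPLEX `S(a; c) = {a_ι < x_ι, ∏ x_ι < c}` (in logarithmic coordinates the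
simplex `{u_ι > log a_ι, ∑ u_ι < log c}` of volume `(log g)ⁿ / n!`, `g = c / ∏ a_ι`). -/

-- stub_simplexExists: LANDED p131095 (imported).

-- stub_orderCellPerm: LANDED p131080 (imported).

-- stub_cubeDecomposition: LANDED p131151 (imported).

-- stub_cumprodMove: LANDED p131780 (imported).

-- stub_simplexToBox: LANDED p131853 (imported).

-- stub_simplexSector: LANDED p131220 (imported).

/-! ### v5: integer-matrix power moves (every Λ-rational simplex), generic splitter, pair forms

For `M ∈ ℤ^{n×n}` with `det M ≠ 0` the monomial map `Φ_M(x, z) = (x^M, z·∏x/∏x^M)` — in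
logarithmic coordinates the linear map `u ↦ Mu` — is a rule-(2) move with CONSTANT Jacobian
`|det M|` on the open orthant; the BINOMIAL CELL `Φ_M⁻¹(S(a; c)) = {a_k < x^{M_k}, ∏_k x^{M_k} < c}`
is then `|det M|⁻¹ • [S(a; c)]`, i.e. KZ-equivalent to a box; in logarithmic coordinates these are
ALL the simplices with rational facet normals. -/

-- stub_matrixPowerMove: LANDED p132643 (imported).

-- stub_binomialCellToBox: LANDED p132746 (imported).

-- stub_binomialSector: LANDED p132255 (imported).

-- stub_unionSplit: LANDED p132236 (imported).

-- stub_simplexPairs: LANDED p132252 (imported).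

-- stub_polygonPairs: LANDED p132428 (imported).

/-! ### v6: the signed scissors layer, corner cuts, slack merge

The sector theorems of v2–v5 are stated for finite DISJOINT unions of boxes / simplices. v6 removes
both restrictions: the class map `ρ ↦ [ρ]` on integrand-`1` representations factors through the
scissors-congruence group (`stub_scissors`), sector families may carry `ℤ`-weights
(`stub_weightedOfFamilies`), and two representations with a.e. signed cell decompositions and
equal value are KZ-equivalent (`stub_pairsOfDecomposition`). `stub_cornerCut` is the first proved
non-simplicial decomposition (log-box cut by a binomial wall), `stub_slackMerge` the
multiplicativity of the toric encoding, `stub_torsionClosure` the passage from boxes to every cell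
with a torsion certificate over boxes. All six are definition-free; the class predicates
`G`, `GB`, `GS` are universally quantified. -/

-- stub_scissors: LANDED p134898 (imported).

-- stub_weightedOfFamilies: LANDED p134218 (imported).

-- stub_pairsOfDecomposition: LANDED p134117 (imported).

-- stub_cornerCut: LANDED p134232 (imported).

-- stub_slackMerge: LANDED p135137 (imported; helpers …SlackMergeAux p134723).

-- stub_torsionClosure: LANDED p134236 (imported).

/-! ### v6 wave 2: certificates (binomial cells, products, corners, parallelepipeds) and the
a.e. cut-box decomposition — the inputs of `certifiedPairs` -/

-- stub_binomialCertificate: LANDED p135528 (imported).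

-- stub_productCertificate: LANDED p135758 (imported).

-- stub_cutBoxDecomposition: LANDED p135487 (imported).

-- stub_cornerCertificate: LANDED p135544 (imported).

-- stub_parallelepipedCertificate: LANDED p135608 (imported).

/-! ### v6 wave 3: proved-decomposition classes (bevelled boxes, overlapping unions of boxes),
inclusion–exclusion, monomial closure of the certified class -/

-- stub_bevelledBoxPairs: LANDED p136212 (imported).

-- stub_indicatorInclusionExclusion: LANDED p136075 (imported).

-- stub_boxUnionPairs: LANDED p136363 (imported).

-- stub_monomialCertificates: LANDED p136154 (imported).

/-! ### v6 wave 4 + lead: the abstract layer beyond the torus — commensurable pairs, the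
Euclidean affine-orbit sector (algebraic simplices, boxes, bevelled boxes, ellipsoids), all LANDED

-- commensurablePairs: LANDED p136455 (…CommensurablePairs.lean).
-- affineOrbitPairs, algebraicSimplexPairs: LANDED p136689 (…AffineOrbitPairs.lean; fed by
--   HyperbolicBloch.OffTetraSectorKernel.stub_affineOrbit).
-- stub_algebraicBoxUnionPairs: LANDED p137071; stub_euclideanCornerCut: LANDED p136821;
-- stub_algebraicBevelledBoxPairs: LANDED p137157; ellipsoidPairs: LANDED p137278 (pending at write time). -/

/-! ## Composition -/

/-- **The rank-two toric box sector of the off-plane frame, every dimension `n + 1`** —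
sorry-free composition of the four toric stubs through `stub_toricAssembly`. [folklore] -/
theorem rankTwoToricBoxes :
    ∀ (n : ℕ) (α β : ℝ), 0 < α → 0 < β → IsAlgebraic ℚ α → IsAlgebraic ℚ β →
      (∀ p q : ℤ, α ^ p * β ^ q = 1 → p = 0 ∧ q = 0) →
      ∀ (k k' : ℕ) (u v u₁ v₁ : Fin k → Fin n → ℤ) (s t s₁ t₁ : Fin k' → Fin n → ℤ)
        (r : Fin k → KZ.IntegralRep (n + 1)) (r' : Fin k' → KZ.IntegralRep (n + 1)),
      (∀ i j, α ^ u i j * β ^ v i j < α ^ u₁ i j * β ^ v₁ i j) →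
      (∀ i j, α ^ s i j * β ^ t i j < α ^ s₁ i j * β ^ t₁ i j) →
      (∀ i, (r i).domain = {p : Fin (n + 1) → ℝ | (∀ j : Fin n,
          α ^ u i j * β ^ v i j < p (Fin.castSucc j) ∧ p (Fin.castSucc j) < α ^ u₁ i j * β ^ v₁ i j) ∧
          0 < p (Fin.last n) ∧ p (Fin.last n) * ∏ j : Fin n, p (Fin.castSucc j) < 1}) →
      (∀ i, ∀ p ∈ (r i).domain, (r i).integrand p = 1) →
      (∀ i, (r' i).domain = {p : Fin (n + 1) → ℝ | (∀ j : Fin n,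
          α ^ s i j * β ^ t i j < p (Fin.castSucc j) ∧ p (Fin.castSucc j) < α ^ s₁ i j * β ^ t₁ i j) ∧
          0 < p (Fin.last n) ∧ p (Fin.last n) * ∏ j : Fin n, p (Fin.castSucc j) < 1}) →
      (∀ i, ∀ p ∈ (r' i).domain, (r' i).integrand p = 1) →
      ∑ i, (r i).value = ∑ i, (r' i).value →
      ∑ i, KZ.of (r i) - ∑ i, KZ.of (r' i) ∈ KZ.relations :=
  stub_toricAssembly stub_logBoxValue stub_logBoxCut stub_logBoxLinear stub_rankTwoLogRatio

/-- **The sector in the crux's own shape (pairs of finite disjoint unions of log-boxes), every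
dimension `n + 1`, unconditional** — `toric_sector_pairs` (helper F) fed with the proved sector.
[folklore] -/
theorem rankTwoToricPairs :
    ∀ (n : ℕ) (α β : ℝ), 0 < α → 0 < β → IsAlgebraic ℚ α → IsAlgebraic ℚ β → (∀ p q : ℤ, α ^ p * β ^ q = 1 → p = 0 ∧ q = 0) → ∀ (k k' : ℕ) (u v u₁ v₁ : Fin k → Fin n → ℤ) (s t s₁ t₁ : Fin k' → Fin n → ℤ) (r r' : KZ.IntegralRep (n + 1)), (∀ i j, α ^ u i j * β ^ v i j < α ^ u₁ i j * β ^ v₁ i j) → (∀ i j, α ^ s i j * β ^ t i j < α ^ s₁ i j * β ^ t₁ i j) → r.domain = (⋃ i, {ξ : Fin (n + 1) → ℝ | (∀ ι : Fin n, (fun j => α ^ u i j * β ^ v i j) ι < ξ (Fin.castSucc ι) ∧ ξ (Fin.castSucc ι) < (fun j => α ^ u₁ i j * β ^ v₁ i j) ι) ∧ 0 < ξ (Fin.last n) ∧ ξ (Fin.last n) * ∏ ι : Fin n, ξ (Fin.castSucc ι) < 1}) → (∀ i i', i ≠ i' → Disjoint {ξ : Fin (n + 1) → ℝ | (∀ ι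 : Fin n, (fun j => α ^ u i j * β ^ v i j) ι < ξ (Fin.castSucc ι) ∧ ξ (Fin.castSucc ι) < (fun j => α ^ u₁ i j * β ^ v₁ i j) ι) ∧ 0 < ξ (Fin.last n) ∧ ξ (Fin.last n) * ∏ ι : Fin n, ξ (Fin.castSucc ι) < 1} {ξ : Fin (n + 1) → ℝ | (∀ ι : Fin n, (fun j => α ^ u i' j * β ^ v i' j) ι < ξ (Fin.castSucc ι) ∧ ξ (Fin.castSucc ι) < (fun j => α ^ u₁ i' j * β ^ v₁ i' j) ι) ∧ 0 < ξ (Fin.last n) ∧ ξ (Fin.last n) * ∏ ι : Fin n, ξ (Fin.castSucc ι) < 1}) → (∀ x ∈ r.domain, r.integrand x = 1) → r'.domain = (⋃ i, {ξ : Fin (n + 1) → ℝ | (∀ ι : Fin n, (fun j => α ^ s i j * β ^ t i j) ι < ξ (Fin.castSucc ι) ∧ ξ (Fin.castSucc ι) < (fun j => α ^ s₁ i j * β ^ t₁ i j) ι) ∧ 0 < ξ (Fin.last n) ∧ ξ (Fin.last n) * ∏ ι : Fin n, ξ (Fin.castSucc ι) < 1}) → (∀ i i', i ≠ i' → Disjoint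 {ξ : Fin (n + 1) → ℝ | (∀ ι : Fin n, (fun j => α ^ s i j * β ^ t i j) ι < ξ (Fin.castSucc ι) ∧ ξ (Fin.castSucc ι) < (fun j => α ^ s₁ i j * β ^ t₁ i j) ι) ∧ 0 < ξ (Fin.last n) ∧ ξ (Fin.last n) * ∏ ι : Fin n, ξ (Fin.castSucc ι) < 1} {ξ : Fin (n + 1) → ℝ | (∀ ι : Fin n, (fun j => α ^ s i' j * β ^ t i' j) ι < ξ (Fin.castSucc ι) ∧ ξ (Fin.castSucc ι) < (fun j => α ^ s₁ i' j * β ^ t₁ i' j) ι) ∧ 0 < ξ (Fin.last n) ∧ ξ (Fin.last n) * ∏ ι : Fin n, ξ (Fin.castSucc ι) < 1}) → (∀ x ∈ r'.domain, r'.integrand x = 1) → r.value = r'.value → KZ.Equivalent r r' :=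
  toric_sector_pairs stub_logBoxCut.1 rankTwoToricBoxes

/-- **The sector with rational exponents (corners `α^u β^v`, `u, v ∈ ℚ`), unconditional** —
`toric_rtb_rat` (helper G) fed with the proved sector. [folklore] -/
theorem rankTwoToricBoxesRat :
    ∀ (n : ℕ) (α β : ℝ), 0 < α → 0 < β → IsAlgebraic ℚ α → IsAlgebraic ℚ β → (∀ p q : ℤ, α ^ p * β ^ q = 1 → p = 0 ∧ q = 0) → ∀ (k k' : ℕ) (u v u₁ v₁ : Fin k → Fin n → ℚ) (s t s₁ t₁ : Fin k' → Fin n → ℚ) (r : Fin k → KZ.IntegralRep (n + 1)) (r' : Fin k' → KZ.IntegralRep (n + 1)), (∀ i j, α ^ ((u i j : ℚ) : ℝ) * β ^ ((v i j : ℚ) : ℝ) < α ^ ((u₁ i j : ℚ) : ℝ) * β ^ ((v₁ i j : ℚ) : ℝ)) → (∀ i j, α ^ ((s i j : ℚ) : ℝ) * β ^ ((t i j : ℚ) : ℝ) < α ^ ((s₁ i j : ℚ) : ℝ) * β ^ ((t₁ i j : ℚ) : ℝ)) → (∀ i, (r i).domain = {p : Fin (n + 1) → ℝ | (∀ j : Fin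 n, α ^ ((u i j : ℚ) : ℝ) * β ^ ((v i j : ℚ) : ℝ) < p (Fin.castSucc j) ∧ p (Fin.castSucc j) < α ^ ((u₁ i j : ℚ) : ℝ) * β ^ ((v₁ i j : ℚ) : ℝ)) ∧ 0 < p (Fin.last n) ∧ p (Fin.last n) * ∏ j : Fin n, p (Fin.castSucc j) < 1}) → (∀ i, ∀ p ∈ (r i).domain, (r i).integrand p = 1) → (∀ i, (r' i).domain = {p : Fin (n + 1) → ℝ | (∀ j : Fin n, α ^ ((s i j : ℚ) : ℝ) * β ^ ((t i j : ℚ) : ℝ) < p (Fin.castSucc j) ∧ p (Fin.castSucc j) < α ^ ((s₁ i j : ℚ) : ℝ) * β ^ ((t₁ i j : ℚ) : ℝ)) ∧ 0 < p (Fin.last n) ∧ p (Fin.last n) * ∏ j : Fin n, p (Fin.castSucc j) < 1}) → (∀ i, ∀ p ∈ (r' i).domain, (r' i).integrand p = 1) → ∑ i, (r i).value = ∑ i, (r' i).value → ∑ i, KZ.of (r i) - ∑ i, KZ.of (r' i) ∈ KZ.relations :=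
  toric_rtb_rat rankTwoToricBoxes

/-- **The sector in arbitrary real-algebraic position (edge ratios in `α^ℚ β^ℚ`), unconditional** —
`toric_rtb_position` (helper H) fed with the proved rational-exponent sector. [folklore] -/
theorem rankTwoToricBoxesPosition :
    ∀ (n : ℕ) (α β : ℝ), 0 < α → 0 < β → IsAlgebraic ℚ α → IsAlgebraic ℚ β → (∀ p q : ℤ, α ^ p * β ^ q = 1 → p = 0 ∧ q = 0) → ∀ (k k' : ℕ) (a : Fin k → Fin n → ℝ) (u v : Fin k → Fin n → ℚ) (a' : Fin k' → Fin n → ℝ) (s t : Fin k' → Fin n → ℚ) (r : Fin k → KZ.IntegralRep (n + 1)) (r' : Fin k' → KZ.IntegralRep (n + 1)), (∀ i j, 0 < a i j) → (∀ i j, IsAlgebraic ℚ (a i j)) → (∀ i j, 1 < α ^ ((u i j : ℚ) : ℝ) * β ^ ((v i j : ℚ) : ℝ)) → (∀ i j, 0 < a' i j) → (∀ i j, IsAlgebraic ℚ (a' i j)) → (∀ i j, 1 < α ^ ((s i j : ℚ) : ℝ) * β ^ ((t i j : ℚ) : ℝ)) → (∀ i, (r i).domain = {p : Fin (n + 1)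 → ℝ | (∀ j : Fin n, a i j < p (Fin.castSucc j) ∧ p (Fin.castSucc j) < a i j * (α ^ ((u i j : ℚ) : ℝ) * β ^ ((v i j : ℚ) : ℝ))) ∧ 0 < p (Fin.last n) ∧ p (Fin.last n) * ∏ j : Fin n, p (Fin.castSucc j) < 1}) → (∀ i, ∀ p ∈ (r i).domain, (r i).integrand p = 1) → (∀ i, (r' i).domain = {p : Fin (n + 1) → ℝ | (∀ j : Fin n, a' i j < p (Fin.castSucc j) ∧ p (Fin.castSucc j) < a' i j * (α ^ ((s i j : ℚ) : ℝ) * β ^ ((t i j : ℚ) : ℝ))) ∧ 0 < p (Fin.last n) ∧ p (Fin.last n) * ∏ j : Fin n, p (Fin.castSucc j) < 1}) → (∀ i, ∀ p ∈ (r' i).domain, (r' i).integrand p = 1) → ∑ i, (r i).value = ∑ i, (r' i).value → ∑ i, KZ.of (r i) - ∑ i, KZ.of (r' i) ∈ KZ.relations :=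
  toric_rtb_position stub_logBoxCut.1 stub_logBoxLinear.1 rankTwoToricBoxesRat

/-- **Hilbert III for log-triangles, dimension `3`, unconditional modulo the four move/existence
stubs** — `stub_triToBox` fed with `stub_triExists`, `stub_powerMove`, `stub_inversionMove`,
`stub_squareSplit`. [folklore] -/
theorem triToBox : (∀ (a b c : ℝ) (i j : ℕ), 0 < a → 0 < b → IsAlgebraic ℚ a → IsAlgebraic ℚ b → IsAlgebraic ℚ c → 1 ≤ i → 1 ≤ j → a ^ i * b ^ j < c → ∀ (r r' : KZ.IntegralRep 3), r.domain = {p : Fin 3 → ℝ | a < p 0 ∧ b < p 1 ∧ p 0 ^ i * p 1 ^ j < c ∧ 0 < p 2 ∧ p 2 * (p 0 * p 1) < 1} → r'.domain = {p : Fin ((2) + 1) → ℝ | (∀ ι : Fin (2), (![a, b]) ι < p (Fin.castSucc ι) ∧ p (Fin.castSucc ι) < (fun ι => ![a, b] ι * ![c / (a ^ i * b ^ j), (c / (a ^ i * b ^ j)) ^ (((2 * i * j : ℕ) : ℝ)⁻¹)] ι) ι) ∧ 0 < p (Fin.last (2)) ∧ p (Fin.last (2)) * ∏ ι : Fin (2),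 p (Fin.castSucc ι) < 1} → (∀ p ∈ r.domain, r.integrand p = 1) → (∀ p ∈ r'.domain, r'.integrand p = 1) → KZ.of r - KZ.of r' ∈ KZ.relations) :=
  stub_triToBox stub_triExists stub_powerMove stub_inversionMove stub_squareSplit

/-- **The rank-two toric polygon sector in dimension `3`** — `stub_mixedSector` fed with
`triToBox` and the proved position-form box sector `rankTwoToricBoxesPosition`. [folklore] -/
theorem mixedPolygonSector : (∀ (α β : ℝ), 0 < α → 0 < β → IsAlgebraic ℚ α → IsAlgebraic ℚ β → (∀ p q : ℤ, α ^ p * β ^ q = 1 → p = 0 ∧ q = 0) → ∀ (k m k' m' : ℕ) (a : Fin k → Fin 2 → ℝ) (u v : Fin k → Fin 2 → ℚ) (ta tb tc : Fin m → ℝ) (ti tj : Fin m → ℕ) (tu tv : Fin m → ℚ) (a' : Fin k' → Fin 2 → ℝ) (u' v' : Fin k' → Fin 2 → ℚ) (ta' tb' tc' : Fin m' → ℝ) (ti' tj' : Fin m' → ℕ) (tu' tv' : Fin m' → ℚ) (rB : Fin k → KZ.IntegralRep 3) (rT : Fin m → KZ.IntegralRep 3) (rB' : Fin k' → KZ.IntegralRep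 3) (rT' : Fin m' → KZ.IntegralRep 3), (∀ i j, 0 < a i j) → (∀ i j, IsAlgebraic ℚ (a i j)) → (∀ i j, 1 < α ^ ((u i j : ℚ) : ℝ) * β ^ ((v i j : ℚ) : ℝ)) → (∀ i, (rB i).domain = {p : Fin (2 + 1) → ℝ | (∀ j : Fin 2, a i j < p (Fin.castSucc j) ∧ p (Fin.castSucc j) < a i j * (α ^ ((u i j : ℚ) : ℝ) * β ^ ((v i j : ℚ) : ℝ))) ∧ 0 < p (Fin.last 2) ∧ p (Fin.last 2) * ∏ j : Fin 2, p (Fin.castSucc j) < 1}) → (∀ i, ∀ p ∈ (rB i).domain, (rB i).integrand p = 1) → (∀ ν, 0 < ta ν) → (∀ ν, 0 < tb ν) → (∀ ν, IsAlgebraic ℚ (ta ν)) → (∀ ν, IsAlgebraic ℚ (tb ν)) → (∀ ν, IsAlgebraic ℚ (tc ν)) → (∀ ν, 1 ≤ ti ν) → (∀ ν, 1 ≤ tj ν) → (∀ ν, tc ν = ta ν ^ ti ν * tb ν ^ tj ν * (α ^ ((tu ν : ℚ) : ℝ) * β ^ ((tv ν : ℚ) : ℝ))) → (∀ ν, 1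 < α ^ ((tu ν : ℚ) : ℝ) * β ^ ((tv ν : ℚ) : ℝ)) → (∀ ν, (rT ν).domain = {p : Fin 3 → ℝ | ta ν < p 0 ∧ tb ν < p 1 ∧ p 0 ^ ti ν * p 1 ^ tj ν < tc ν ∧ 0 < p 2 ∧ p 2 * (p 0 * p 1) < 1}) → (∀ ν, ∀ p ∈ (rT ν).domain, (rT ν).integrand p = 1) → (∀ i j, 0 < a' i j) → (∀ i j, IsAlgebraic ℚ (a' i j)) → (∀ i j, 1 < α ^ ((u' i j : ℚ) : ℝ) * β ^ ((v' i j : ℚ) : ℝ)) → (∀ i, (rB' i).domain = {p : Fin (2 + 1) → ℝ | (∀ j : Fin 2, a' i j < p (Fin.castSucc j) ∧ p (Fin.castSucc j) < a' i j * (α ^ ((u' i j : ℚ) : ℝ) * β ^ ((v' i j : ℚ) : ℝ))) ∧ 0 < p (Fin.last 2) ∧ p (Fin.last 2) * ∏ j : Fin 2, p (Fin.castSucc j) < 1}) → (∀ i, ∀ p ∈ (rB' i).domain, (rB' i).integrand p = 1) → (∀ ν, 0 < ta' ν) → (∀ ν, 0 < tb' ν) → (∀ ν, IsAlgebraic ℚ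 (ta' ν)) → (∀ ν, IsAlgebraic ℚ (tb' ν)) → (∀ ν, IsAlgebraic ℚ (tc' ν)) → (∀ ν, 1 ≤ ti' ν) → (∀ ν, 1 ≤ tj' ν) → (∀ ν, tc' ν = ta' ν ^ ti' ν * tb' ν ^ tj' ν * (α ^ ((tu' ν : ℚ) : ℝ) * β ^ ((tv' ν : ℚ) : ℝ))) → (∀ ν, 1 < α ^ ((tu' ν : ℚ) : ℝ) * β ^ ((tv' ν : ℚ) : ℝ)) → (∀ ν, (rT' ν).domain = {p : Fin 3 → ℝ | ta' ν < p 0 ∧ tb' ν < p 1 ∧ p 0 ^ ti' ν * p 1 ^ tj' ν < tc' ν ∧ 0 < p 2 ∧ p 2 * (p 0 * p 1) < 1}) → (∀ ν, ∀ p ∈ (rT' ν).domain, (rT' ν).integrand p = 1) → ∑ ν, (rB ν).value + ∑ ν, (rT ν).value = ∑ ν, (rB' ν).value + ∑ ν, (rT' ν).value → (∑ ν, KZ.of (rB ν) + ∑ ν, KZ.of (rT ν)) - (∑ ν, KZ.of (rB' ν) + ∑ ν, KZ.of (rT' ν)) ∈ KZ.relations) :=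
  stub_mixedSector triToBox rankTwoToricBoxesPosition

/-- **The divided power in every dimension, modulo the four v4 stubs** — `stub_simplexToBox` fed
with `stub_simplexExists`, `stub_orderCellPerm`, `stub_cubeDecomposition`, `stub_cumprodMove`. [folklore] -/
theorem simplexToBox : (∀ (n : ℕ) (a : Fin (n + 1) → ℝ) (c : ℝ), (∀ ι, 0 < a ι) → (∀ ι, IsAlgebraic ℚ (a ι)) → IsAlgebraic ℚ c → ∏ ι, a ι < c → ∀ (r r' : KZ.IntegralRep (n + 1 + 1)), r.domain = {p : Fin ((n + 1) + 1) → ℝ | (∀ ι : Fin (n + 1), (a) ι < p (Fin.castSucc ι)) ∧ ∏ ι : Fin (n + 1), p (Fin.castSucc ι) < c ∧ 0 < p (Fin.last (n + 1)) ∧ p (Fin.last (n + 1)) * ∏ ι : Fin (n + 1), p (Fin.castSucc ι) < 1} → r'.domain = {p : Fin ((n + 1) + 1) → ℝ | (∀ ι : Fin (n + 1), (a) ι < p (Fin.castSucc ι) ∧ p (Fin.castSucc ι) < (fun ι => a ι * Function.update (fun _ : Fin (n + 1) => c / ∏ κ, a κ) 0 ((c / ∏ κ, a κ) ^ (((n +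 1).factorial : ℝ)⁻¹)) ι) ι) ∧ 0 < p (Fin.last (n + 1)) ∧ p (Fin.last (n + 1)) * ∏ ι : Fin (n + 1), p (Fin.castSucc ι) < 1} → (∀ p ∈ r.domain, r.integrand p = 1) → (∀ p ∈ r'.domain, r'.integrand p = 1) → KZ.of r - KZ.of r' ∈ KZ.relations) :=
  stub_simplexToBox stub_simplexExists stub_orderCellPerm stub_cubeDecomposition stub_cumprodMove

/-- **The mixed simplex/box sector in every dimension** — `stub_simplexSector` fed with
`simplexToBox` and the proved position-form box sector `rankTwoToricBoxesPosition`. [folklore] -/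
theorem mixedSimplexSector : (∀ (n : ℕ) (α β : ℝ), 0 < α → 0 < β → IsAlgebraic ℚ α → IsAlgebraic ℚ β → (∀ p q : ℤ, α ^ p * β ^ q = 1 → p = 0 ∧ q = 0) → ∀ (k m k' m' : ℕ) (a : Fin k → Fin (n + 1) → ℝ) (u v : Fin k → Fin (n + 1) → ℚ) (sa : Fin m → Fin (n + 1) → ℝ) (sc : Fin m → ℝ) (su sv : Fin m → ℚ) (a' : Fin k' → Fin (n + 1) → ℝ) (u' v' : Fin k' → Fin (n + 1) → ℚ) (sa' : Fin m' → Fin (n + 1) → ℝ) (sc' : Fin m' → ℝ) (su' sv' : Fin m' → ℚ) (rB : Fin k → KZ.IntegralRep (n + 1 + 1)) (rS : Fin m → KZ.IntegralRep (n + 1 + 1)) (rB' : Fin k' → KZ.IntegralRep (n + 1 + 1)) (rS' : Fin m' → KZ.IntegralRep (n + 1 + 1)), (∀ i j, 0 < a i j) → (∀ i j, IsAlgebraic ℚ (a i j)) → (∀ i j, 1 < α ^ ((u i j : ℚ) : ℝ) * β ^ ((v i j : ℚ) : ℝ)) → (∀ i, (rB i).domain = {p : Fin (n + 1 + 1) →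 ℝ | (∀ j : Fin (n + 1), a i j < p (Fin.castSucc j) ∧ p (Fin.castSucc j) < a i j * (α ^ ((u i j : ℚ) : ℝ) * β ^ ((v i j : ℚ) : ℝ))) ∧ 0 < p (Fin.last (n + 1)) ∧ p (Fin.last (n + 1)) * ∏ j : Fin (n + 1), p (Fin.castSucc j) < 1}) → (∀ i, ∀ p ∈ (rB i).domain, (rB i).integrand p = 1) → (∀ ν ι, 0 < sa ν ι) → (∀ ν ι, IsAlgebraic ℚ (sa ν ι)) → (∀ ν, IsAlgebraic ℚ (sc ν)) → (∀ ν, sc ν = (∏ ι, sa ν ι) * (α ^ ((su ν : ℚ) : ℝ) * β ^ ((sv ν : ℚ) : ℝ))) → (∀ ν, 1 < α ^ ((su ν : ℚ) : ℝ) * β ^ ((sv ν : ℚ) : ℝ)) → (∀ ν, (rS ν).domain = {p : Fin ((n + 1) + 1) → ℝ | (∀ ι : Fin (n + 1), (sa ν) ι < p (Fin.castSucc ι)) ∧ ∏ ι : Fin (n + 1), p (Fin.castSucc ι) < sc ν ∧ 0 < p (Fin.last (n + 1)) ∧ p (Fin.last (n + 1)) * ∏ ι : Fin (n + 1), p (Fin.castSucc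 ι) < 1}) → (∀ ν, ∀ p ∈ (rS ν).domain, (rS ν).integrand p = 1) → (∀ i j, 0 < a' i j) → (∀ i j, IsAlgebraic ℚ (a' i j)) → (∀ i j, 1 < α ^ ((u' i j : ℚ) : ℝ) * β ^ ((v' i j : ℚ) : ℝ)) → (∀ i, (rB' i).domain = {p : Fin (n + 1 + 1) → ℝ | (∀ j : Fin (n + 1), a' i j < p (Fin.castSucc j) ∧ p (Fin.castSucc j) < a' i j * (α ^ ((u' i j : ℚ) : ℝ) * β ^ ((v' i j : ℚ) : ℝ))) ∧ 0 < p (Fin.last (n + 1)) ∧ p (Fin.last (n + 1)) * ∏ j : Fin (n + 1), p (Fin.castSucc j) < 1}) → (∀ i, ∀ p ∈ (rB' i).domain, (rB' i).integrand p = 1) → (∀ ν ι, 0 < sa' ν ι) → (∀ ν ι, IsAlgebraic ℚ (sa' ν ι)) → (∀ ν, IsAlgebraic ℚ (sc' ν)) → (∀ ν, sc' ν = (∏ ι, sa' ν ι) * (α ^ ((su' ν : ℚ) : ℝ) * β ^ ((sv' ν : ℚ) : ℝ))) → (∀ ν, 1 < α ^ ((su' ν : ℚ) : ℝ) * β ^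 ((sv' ν : ℚ) : ℝ)) → (∀ ν, (rS' ν).domain = {p : Fin ((n + 1) + 1) → ℝ | (∀ ι : Fin (n + 1), (sa' ν) ι < p (Fin.castSucc ι)) ∧ ∏ ι : Fin (n + 1), p (Fin.castSucc ι) < sc' ν ∧ 0 < p (Fin.last (n + 1)) ∧ p (Fin.last (n + 1)) * ∏ ι : Fin (n + 1), p (Fin.castSucc ι) < 1}) → (∀ ν, ∀ p ∈ (rS' ν).domain, (rS' ν).integrand p = 1) → ∑ ν, (rB ν).value + ∑ ν, (rS ν).value = ∑ ν, (rB' ν).value + ∑ ν, (rS' ν).value → (∑ ν, KZ.of (rB ν) + ∑ ν, KZ.of (rS ν)) - (∑ ν, KZ.of (rB' ν) + ∑ ν, KZ.of (rS' ν)) ∈ KZ.relations) :=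
  stub_simplexSector simplexToBox rankTwoToricBoxesPosition

/-- **Every binomial cell is a box, modulo `stub_matrixPowerMove`.** [folklore] -/
theorem binomialCellToBox : (∀ (n : ℕ) (M : Matrix (Fin (n + 1)) (Fin (n + 1)) ℤ) (a : Fin (n + 1) → ℝ) (c : ℝ), M.det ≠ 0 → (∀ ι, 0 < a ι) → (∀ ι, IsAlgebraic ℚ (a ι)) → IsAlgebraic ℚ c → ∏ ι, a ι < c → ∀ (r r' : KZ.IntegralRep (n + 1 + 1)), r.domain = {p : Fin ((n + 1) + 1) → ℝ | (∀ ι : Fin (n + 1), 0 < p (Fin.castSucc ι)) ∧ (∀ k : Fin (n + 1), (a) k < ∏ j : Fin (n + 1), p (Fin.castSucc j) ^ (M k j)) ∧ ∏ k : Fin (n + 1), ∏ j : Fin (n + 1), p (Fin.castSucc j) ^ (M k j) < c ∧ 0 < p (Fin.last (n + 1)) ∧ p (Fin.last (n + 1)) * ∏ ι : Fin (n + 1), p (Fin.castSucc ι) < 1} → r'.domain = {p : Fin ((n + 1) + 1) → ℝ | (∀ ι : Fin (n + 1), (fun _ => (1:ℝ)) ι < p (Fin.castSucc ι) ∧ p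 (Fin.castSucc ι) < (Function.update (fun _ : Fin (n + 1) => c / ∏ κ, a κ) 0 ((c / ∏ κ, a κ) ^ (((M.det.natAbs * (n + 1).factorial : ℕ) : ℝ)⁻¹))) ι) ∧ 0 < p (Fin.last (n + 1)) ∧ p (Fin.last (n + 1)) * ∏ ι : Fin (n + 1), p (Fin.castSucc ι) < 1} → (∀ p ∈ r.domain, r.integrand p = 1) → (∀ p ∈ r'.domain, r'.integrand p = 1) → KZ.of r - KZ.of r' ∈ KZ.relations) :=
  stub_binomialCellToBox stub_matrixPowerMove

/-- **The binomial-cell sector in every dimension** — `stub_binomialSector` fed with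
`binomialCellToBox` and `rankTwoToricBoxesPosition`. [folklore] -/
theorem binomialSector : (∀ (n : ℕ) (α β : ℝ), 0 < α → 0 < β → IsAlgebraic ℚ α → IsAlgebraic ℚ β → (∀ p q : ℤ, α ^ p * β ^ q = 1 → p = 0 ∧ q = 0) → ∀ (k m k' m' : ℕ) (a : Fin k → Fin (n + 1) → ℝ) (u v : Fin k → Fin (n + 1) → ℚ) (sM : Fin m → Matrix (Fin (n + 1)) (Fin (n + 1)) ℤ) (sa : Fin m → Fin (n + 1) → ℝ) (sc : Fin m → ℝ) (su sv : Fin m → ℚ) (a' : Fin k' → Fin (n + 1) → ℝ) (u' v' : Fin k' → Fin (n + 1) → ℚ) (sM' : Fin m' → Matrix (Fin (n + 1)) (Fin (n + 1)) ℤ) (sa' : Fin m' → Fin (n + 1) → ℝ) (sc' : Fin m' → ℝ) (su' sv' : Fin m' → ℚ) (rB : Fin k → KZ.IntegralRep (n + 1 + 1)) (rS : Fin m → KZ.IntegralRep (n + 1 + 1)) (rB' : Fin k' → KZ.IntegralRep (n + 1 + 1)) (rS' : Fin m' → KZ.IntegralRep (n + 1 + 1)), (∀ i j, 0 < a i j)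 → (∀ i j, IsAlgebraic ℚ (a i j)) → (∀ i j, 1 < α ^ ((u i j : ℚ) : ℝ) * β ^ ((v i j : ℚ) : ℝ)) → (∀ i, (rB i).domain = {p : Fin (n + 1 + 1) → ℝ | (∀ j : Fin (n + 1), a i j < p (Fin.castSucc j) ∧ p (Fin.castSucc j) < a i j * (α ^ ((u i j : ℚ) : ℝ) * β ^ ((v i j : ℚ) : ℝ))) ∧ 0 < p (Fin.last (n + 1)) ∧ p (Fin.last (n + 1)) * ∏ j : Fin (n + 1), p (Fin.castSucc j) < 1}) → (∀ i, ∀ p ∈ (rB i).domain, (rB i).integrand p = 1) → (∀ ν, ((sM) ν).det ≠ 0) → (∀ ν ι, 0 < sa ν ι) → (∀ ν ι, IsAlgebraic ℚ (sa ν ι)) → (∀ ν, IsAlgebraic ℚ (sc ν)) → (∀ ν, sc ν = (∏ ι, sa ν ι) * (α ^ ((su ν : ℚ) : ℝ) * β ^ ((sv ν : ℚ) : ℝ))) → (∀ ν, 1 < α ^ ((su ν : ℚ) : ℝ) * β ^ ((sv ν : ℚ) : ℝ)) → (∀ ν, (rS ν).domain = {p : Fin ((n + 1) + 1) → ℝ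 | (∀ ι : Fin (n + 1), 0 < p (Fin.castSucc ι)) ∧ (∀ k : Fin (n + 1), (sa ν) k < ∏ j : Fin (n + 1), p (Fin.castSucc j) ^ (sM ν k j)) ∧ ∏ k : Fin (n + 1), ∏ j : Fin (n + 1), p (Fin.castSucc j) ^ (sM ν k j) < sc ν ∧ 0 < p (Fin.last (n + 1)) ∧ p (Fin.last (n + 1)) * ∏ ι : Fin (n + 1), p (Fin.castSucc ι) < 1}) → (∀ ν, ∀ p ∈ (rS ν).domain, (rS ν).integrand p = 1) → (∀ i j, 0 < a' i j) → (∀ i j, IsAlgebraic ℚ (a' i j)) → (∀ i j, 1 < α ^ ((u' i j : ℚ) : ℝ) * β ^ ((v' i j : ℚ) : ℝ)) → (∀ i, (rB' i).domain = {p : Fin (n + 1 + 1) → ℝ | (∀ j : Fin (n + 1), a' i j < p (Fin.castSucc j) ∧ p (Fin.castSucc j) < a' i j * (α ^ ((u' i j : ℚ) : ℝ) * β ^ ((v' i j : ℚ) : ℝ))) ∧ 0 < p (Fin.last (n + 1)) ∧ p (Fin.last (n + 1)) * ∏ j : Fin (n + 1), p (Fin.castSucc j) < 1}) → (∀ i,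 ∀ p ∈ (rB' i).domain, (rB' i).integrand p = 1) → (∀ ν, ((sM') ν).det ≠ 0) → (∀ ν ι, 0 < sa' ν ι) → (∀ ν ι, IsAlgebraic ℚ (sa' ν ι)) → (∀ ν, IsAlgebraic ℚ (sc' ν)) → (∀ ν, sc' ν = (∏ ι, sa' ν ι) * (α ^ ((su' ν : ℚ) : ℝ) * β ^ ((sv' ν : ℚ) : ℝ))) → (∀ ν, 1 < α ^ ((su' ν : ℚ) : ℝ) * β ^ ((sv' ν : ℚ) : ℝ)) → (∀ ν, (rS' ν).domain = {p : Fin ((n + 1) + 1) → ℝ | (∀ ι : Fin (n + 1), 0 < p (Fin.castSucc ι)) ∧ (∀ k : Fin (n + 1), (sa' ν) k < ∏ j : Fin (n + 1), p (Fin.castSucc j) ^ (sM' ν k j)) ∧ ∏ k : Fin (n + 1), ∏ j : Fin (n + 1), p (Fin.castSucc j) ^ (sM' ν k j) < sc' ν ∧ 0 < p (Fin.last (n + 1)) ∧ p (Fin.last (n + 1)) * ∏ ι : Fin (n + 1), p (Fin.castSucc ι) < 1}) → (∀ ν, ∀ p ∈ (rS' ν).domain, (rS' ν).integrand p = 1)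 → ∑ ν, (rB ν).value + ∑ ν, (rS ν).value = ∑ ν, (rB' ν).value + ∑ ν, (rS' ν).value → (∑ ν, KZ.of (rB ν) + ∑ ν, KZ.of (rS ν)) - (∑ ν, KZ.of (rB' ν) + ∑ ν, KZ.of (rS' ν)) ∈ KZ.relations) :=
  stub_binomialSector binomialCellToBox rankTwoToricBoxesPosition

/-- **Pair form of the simplex/box sector.** [folklore] -/
theorem simplexPairs : (∀ (n : ℕ) (α β : ℝ), 0 < α → 0 < β → IsAlgebraic ℚ α → IsAlgebraic ℚ β → (∀ p q : ℤ, α ^ p * β ^ q = 1 → p = 0 ∧ q = 0) → ∀ (k m k' m' : ℕ) (a : Fin k → Fin (n + 1) → ℝ) (u v : Fin k → Fin (n + 1) → ℚ) (sa : Fin m → Fin (n + 1) → ℝ) (sc : Fin m → ℝ) (su sv : Fin m → ℚ) (a' : Fin k' → Fin (n + 1) → ℝ) (u' v' : Fin k' → Fin (n + 1) → ℚ) (sa' : Fin m' → Fin (n + 1) → ℝ) (sc' : Fin m' → ℝ) (su' sv' : Fin m' → ℚ) (rB : Fin k → KZ.IntegralRep (n + 1 + 1)) (rS : Fin m → KZ.IntegralRep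 (n + 1 + 1)) (rB' : Fin k' → KZ.IntegralRep (n + 1 + 1)) (rS' : Fin m' → KZ.IntegralRep (n + 1 + 1)) (r r' : KZ.IntegralRep (n + 1 + 1)), (∀ i j, 0 < a i j) → (∀ i j, IsAlgebraic ℚ (a i j)) → (∀ i j, 1 < α ^ ((u i j : ℚ) : ℝ) * β ^ ((v i j : ℚ) : ℝ)) → (∀ i, (rB i).domain = {p : Fin (n + 1 + 1) → ℝ | (∀ j : Fin (n + 1), a i j < p (Fin.castSucc j) ∧ p (Fin.castSucc j) < a i j * (α ^ ((u i j : ℚ) : ℝ) * β ^ ((v i j : ℚ) : ℝ))) ∧ 0 < p (Fin.last (n + 1)) ∧ p (Fin.last (n + 1)) * ∏ j : Fin (n + 1), p (Fin.castSucc j) < 1}) → (∀ i, ∀ p ∈ (rB i).domain, (rB i).integrand p = 1) → (∀ ν ι, 0 < sa ν ι) → (∀ ν ι, IsAlgebraic ℚ (sa ν ι)) → (∀ ν, IsAlgebraic ℚ (sc ν)) → (∀ ν, sc ν = (∏ ι, sa ν ι) * (α ^ ((su ν : ℚ) : ℝ) * β ^ ((sv ν : ℚ) : ℝ))) → (∀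 ν, 1 < α ^ ((su ν : ℚ) : ℝ) * β ^ ((sv ν : ℚ) : ℝ)) → (∀ ν, (rS ν).domain = {p : Fin ((n + 1) + 1) → ℝ | (∀ ι : Fin (n + 1), (sa ν) ι < p (Fin.castSucc ι)) ∧ ∏ ι : Fin (n + 1), p (Fin.castSucc ι) < sc ν ∧ 0 < p (Fin.last (n + 1)) ∧ p (Fin.last (n + 1)) * ∏ ι : Fin (n + 1), p (Fin.castSucc ι) < 1}) → (∀ ν, ∀ p ∈ (rS ν).domain, (rS ν).integrand p = 1) → (∀ i j, 0 < a' i j) → (∀ i j, IsAlgebraic ℚ (a' i j)) → (∀ i j, 1 < α ^ ((u' i j : ℚ) : ℝ) * β ^ ((v' i j : ℚ) : ℝ)) → (∀ i, (rB' i).domain = {p : Fin (n + 1 + 1) → ℝ | (∀ j : Fin (n + 1), a' i j < p (Fin.castSucc j) ∧ p (Fin.castSucc j) < a' i j * (α ^ ((u' i j : ℚ) : ℝ) * β ^ ((v' i j : ℚ) : ℝ))) ∧ 0 < p (Fin.last (n + 1)) ∧ p (Fin.last (n + 1)) * ∏ j : Fin (n + 1), p (Fin.castSucc j) < 1}) →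 (∀ i, ∀ p ∈ (rB' i).domain, (rB' i).integrand p = 1) → (∀ ν ι, 0 < sa' ν ι) → (∀ ν ι, IsAlgebraic ℚ (sa' ν ι)) → (∀ ν, IsAlgebraic ℚ (sc' ν)) → (∀ ν, sc' ν = (∏ ι, sa' ν ι) * (α ^ ((su' ν : ℚ) : ℝ) * β ^ ((sv' ν : ℚ) : ℝ))) → (∀ ν, 1 < α ^ ((su' ν : ℚ) : ℝ) * β ^ ((sv' ν : ℚ) : ℝ)) → (∀ ν, (rS' ν).domain = {p : Fin ((n + 1) + 1) → ℝ | (∀ ι : Fin (n + 1), (sa' ν) ι < p (Fin.castSucc ι)) ∧ ∏ ι : Fin (n + 1), p (Fin.castSucc ι) < sc' ν ∧ 0 < p (Fin.last (n + 1)) ∧ p (Fin.last (n + 1)) * ∏ ι : Fin (n + 1), p (Fin.castSucc ι) < 1}) → (∀ ν, ∀ p ∈ (rS' ν).domain, (rS' ν).integrand p = 1) → r.domain = (⋃ i, (rB i).domain) ∪ (⋃ ν, (rS ν).domain) → (∀ i j, i ≠ j → Disjoint ((rB) i).domain ((rB) j).domain) → (∀ ν μ, ν ≠ μ → Disjoint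 ((rS) ν).domain ((rS) μ).domain) → (∀ i ν, Disjoint ((rB) i).domain ((rS) ν).domain) → (∀ p ∈ r.domain, r.integrand p = 1) → r'.domain = (⋃ i, (rB' i).domain) ∪ (⋃ ν, (rS' ν).domain) → (∀ i j, i ≠ j → Disjoint ((rB') i).domain ((rB') j).domain) → (∀ ν μ, ν ≠ μ → Disjoint ((rS') ν).domain ((rS') μ).domain) → (∀ i ν, Disjoint ((rB') i).domain ((rS') ν).domain) → (∀ p ∈ r'.domain, r'.integrand p = 1) → r.value = r'.value → KZ.Equivalent r r') :=
  stub_simplexPairs stub_unionSplit mixedSimplexSector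

/-- **Pair form of the polygon sector (dimension `3`).** [folklore] -/
theorem polygonPairs : (∀ (α β : ℝ), 0 < α → 0 < β → IsAlgebraic ℚ α → IsAlgebraic ℚ β → (∀ p q : ℤ, α ^ p * β ^ q = 1 → p = 0 ∧ q = 0) → ∀ (k m k' m' : ℕ) (a : Fin k → Fin 2 → ℝ) (u v : Fin k → Fin 2 → ℚ) (ta tb tc : Fin m → ℝ) (ti tj : Fin m → ℕ) (tu tv : Fin m → ℚ) (a' : Fin k' → Fin 2 → ℝ) (u' v' : Fin k' → Fin 2 → ℚ) (ta' tb' tc' : Fin m' → ℝ) (ti' tj' : Fin m' → ℕ) (tu' tv' : Fin m' → ℚ) (rB : Fin k → KZ.IntegralRep 3) (rT : Fin m → KZ.IntegralRep 3) (rB' : Fin k' → KZ.IntegralRep 3) (rT' : Fin m' → KZ.IntegralRep 3) (r r' : KZ.IntegralRep 3), (∀ i j, 0 < a i j) → (∀ i j, IsAlgebraic ℚ (a i j)) → (∀ i j, 1 < α ^ ((u i j : ℚ) : ℝ) * β ^ ((v i j : ℚ) : ℝ)) → (∀ i, (rB i).domain = {p : Fin (2 + 1) → ℝ | (∀ j :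 Fin 2, a i j < p (Fin.castSucc j) ∧ p (Fin.castSucc j) < a i j * (α ^ ((u i j : ℚ) : ℝ) * β ^ ((v i j : ℚ) : ℝ))) ∧ 0 < p (Fin.last 2) ∧ p (Fin.last 2) * ∏ j : Fin 2, p (Fin.castSucc j) < 1}) → (∀ i, ∀ p ∈ (rB i).domain, (rB i).integrand p = 1) → (∀ ν, 0 < ta ν) → (∀ ν, 0 < tb ν) → (∀ ν, IsAlgebraic ℚ (ta ν)) → (∀ ν, IsAlgebraic ℚ (tb ν)) → (∀ ν, IsAlgebraic ℚ (tc ν)) → (∀ ν, 1 ≤ ti ν) → (∀ ν, 1 ≤ tj ν) → (∀ ν, tc ν = ta ν ^ ti ν * tb ν ^ tj ν * (α ^ ((tu ν : ℚ) : ℝ) * β ^ ((tv ν : ℚ) : ℝ))) → (∀ ν, 1 < α ^ ((tu ν : ℚ) : ℝ) * β ^ ((tv ν : ℚ) : ℝ)) → (∀ ν, (rT ν).domain = {p : Fin 3 → ℝ | ta ν < p 0 ∧ tb ν < p 1 ∧ p 0 ^ ti ν * p 1 ^ tj ν < tc ν ∧ 0 < p 2 ∧ p 2 * (p 0 * p 1)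 < 1}) → (∀ ν, ∀ p ∈ (rT ν).domain, (rT ν).integrand p = 1) → (∀ i j, 0 < a' i j) → (∀ i j, IsAlgebraic ℚ (a' i j)) → (∀ i j, 1 < α ^ ((u' i j : ℚ) : ℝ) * β ^ ((v' i j : ℚ) : ℝ)) → (∀ i, (rB' i).domain = {p : Fin (2 + 1) → ℝ | (∀ j : Fin 2, a' i j < p (Fin.castSucc j) ∧ p (Fin.castSucc j) < a' i j * (α ^ ((u' i j : ℚ) : ℝ) * β ^ ((v' i j : ℚ) : ℝ))) ∧ 0 < p (Fin.last 2) ∧ p (Fin.last 2) * ∏ j : Fin 2, p (Fin.castSucc j) < 1}) → (∀ i, ∀ p ∈ (rB' i).domain, (rB' i).integrand p = 1) → (∀ ν, 0 < ta' ν) → (∀ ν, 0 < tb' ν) → (∀ ν, IsAlgebraic ℚ (ta' ν)) → (∀ ν, IsAlgebraic ℚ (tb' ν)) → (∀ ν, IsAlgebraic ℚ (tc' ν)) → (∀ ν, 1 ≤ ti' ν) → (∀ ν, 1 ≤ tj' ν) → (∀ ν, tc' ν = ta' ν ^ ti' ν * tb' ν ^ tj' ν * (α ^ ((tu' ν : ℚ)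 : ℝ) * β ^ ((tv' ν : ℚ) : ℝ))) → (∀ ν, 1 < α ^ ((tu' ν : ℚ) : ℝ) * β ^ ((tv' ν : ℚ) : ℝ)) → (∀ ν, (rT' ν).domain = {p : Fin 3 → ℝ | ta' ν < p 0 ∧ tb' ν < p 1 ∧ p 0 ^ ti' ν * p 1 ^ tj' ν < tc' ν ∧ 0 < p 2 ∧ p 2 * (p 0 * p 1) < 1}) → (∀ ν, ∀ p ∈ (rT' ν).domain, (rT' ν).integrand p = 1) → r.domain = (⋃ i, (rB i).domain) ∪ (⋃ ν, (rT ν).domain) → (∀ i j, i ≠ j → Disjoint ((rB) i).domain ((rB) j).domain) → (∀ ν μ, ν ≠ μ → Disjoint ((rT) ν).domain ((rT) μ).domain) → (∀ i ν, Disjoint ((rB) i).domain ((rT) ν).domain) → (∀ p ∈ r.domain, r.integrand p = 1) → r'.domain = (⋃ i, (rB' i).domain) ∪ (⋃ ν, (rT' ν).domain) → (∀ i j, i ≠ j → Disjoint ((rB') i).domain ((rB') j).domain) → (∀ ν μ, ν ≠ μ → Disjoint ((rT') ν).domain ((rT') μ).domain) → (∀ i ν, Disjoint ((rB') i).domain ((rT')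 ν).domain) → (∀ p ∈ r'.domain, r'.integrand p = 1) → r.value = r'.value → KZ.Equivalent r r') :=
  stub_polygonPairs stub_unionSplit mixedPolygonSector

/-! ### v6 compositions: ℤ-weighted Λ-boxes, certified cells, pairs from signed decompositions -/

-- weightedBoxes, certifiedPairs (+ certifiedPairsFintype, simplexDecompositionPairs): LANDED p135886
-- (…Theorems/SymplecticScissorsVolumeFormOffPlaneCertifiedPairs.lean, imported).

/-! ### v7 (continuation lead c3): TWO PERIODS — algebraic-point cells ⊕ one transcendental body

A K-CELL is an integrand-`1` representation `ρ` with a certificate `[ρ] − [pt, v] ∈ relations`,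
`v` real algebraic (`KZ.IntegralRep.unit.constMul v hv`): boxes, algebraic simplices (Dirichlet
peeling, `stub_simplexCell`), polynomial subgraphs over rational boxes (rule (3),
`stub_subgraphToBase`, and the tree's cube polynomial kernel, `stub_polynomialBoxCell`), products.
K-cells have the `ℤ`-weighted property (`stub_pointCellsWeighted`), so a.e. signed combinations
of K-cells with equal volume are KZ-equivalent (`pointCellPairs`). A second class — the
real-algebraic affine orbit of ONE body `B` whose volume is TRANSCENDENTAL (the unit ball `B_d`,
`d ≥ 2`, by Lindemann's theorem proved in the tree, `stub_ballVolumeTranscendental`) — MIXES with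
the K-cells: equal total volume forces the algebraic part and the `vol B`-part to agree separately
(`stub_periodSplit`), and each part is a relation (`pointCellOrbitPairs`, `pointCellBallPairs`,
`polytopeBallPairs`). All six stubs are definition-free. -/

/-- **Stub (v7-1, the `ℤ`-weighted property of K-cells).** A weighted family of integrand-`1`
representations each carrying (where its weight is non-zero) a certificate
`[σ j] − [pt, v j] ∈ relations` with `v j` real algebraic, and with total weighted value `0`, has
weighted formal sum in `relations`: `value (σ j) = v j` (soundness), the constants `[pt, v j]` on
the common domain `ℝ⁰` combine by rule (1b) into `[pt, Σ w j v j] = [pt, 0]`, a zero integrand.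
[Kontsevich–Zagier 2001, §1.2 rule (1)] [folklore] -/
theorem stub_pointCellsWeighted : ∀ (N k : ℕ) (σ : Fin k → KZ.IntegralRep N) (w : Fin k → ℤ),
    (∀ j, w j ≠ 0 → ∃ (v : ℝ) (hv : IsAlgebraic ℚ v),
      KZ.of (σ j) - KZ.of (KZ.IntegralRep.unit.constMul v hv) ∈ KZ.relations) →
    ∑ j, (w j : ℝ) * (σ j).value = 0 → ∑ j, w j • KZ.of (σ j) ∈ KZ.relations := by
  sorry

/-- **Stub (v7-2, PERIOD SPLITTING).** Two classes `GB`, `GS` of representations with values in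
`ℚ̄·ω₁` and `ℚ̄·ω₂` respectively, `ω₁, ω₂` linearly independent over the real algebraic numbers,
each with the `ℤ`-weighted property, have the JOINT weighted property: a vanishing mixed weighted
sum of values `a ω₁ + b ω₂ = 0` (`a, b ∈ ℚ̄`) forces `a = b = 0`, so each half is a relation. Pure
algebra; the second input of `stub_pairsOfDecomposition`. [folklore] -/
theorem stub_periodSplit : ∀ (N : ℕ) (GB GS : KZ.IntegralRep N → Prop) (ω₁ ω₂ : ℝ),
    (∀ a b : ℝ, IsAlgebraic ℚ a → IsAlgebraic ℚ b → a * ω₁ + b * ω₂ = 0 → a = 0 ∧ b = 0) →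
    (∀ ρ, GB ρ → ∃ a : ℝ, IsAlgebraic ℚ a ∧ ρ.value = a * ω₁) →
    (∀ ρ, GS ρ → ∃ b : ℝ, IsAlgebraic ℚ b ∧ ρ.value = b * ω₂) →
    (∀ (k : ℕ) (σ : Fin k → KZ.IntegralRep N) (w : Fin k → ℤ), (∀ j, w j ≠ 0 → GB (σ j)) →
      ∑ j, (w j : ℝ) * (σ j).value = 0 → ∑ j, w j • KZ.of (σ j) ∈ KZ.relations) →
    (∀ (k : ℕ) (σ : Fin k → KZ.IntegralRep N) (w : Fin k → ℤ), (∀ j, w j ≠ 0 → GS (σ j)) →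
      ∑ j, (w j : ℝ) * (σ j).value = 0 → ∑ j, w j • KZ.of (σ j) ∈ KZ.relations) →
    ∀ (k m : ℕ) (ρB : Fin k → KZ.IntegralRep N) (ρS : Fin m → KZ.IntegralRep N)
      (cB : Fin k → ℤ) (cS : Fin m → ℤ),
      (∀ i, cB i ≠ 0 → GB (ρB i)) → (∀ ν, cS ν ≠ 0 → GS (ρS ν)) →
      ∑ i, (cB i : ℝ) * (ρB i).value + ∑ ν, (cS ν : ℝ) * (ρS ν).value = 0 →
      ∑ i, cB i • KZ.of (ρB i) + ∑ ν, cS ν • KZ.of (ρS ν) ∈ KZ.relations := by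
  sorry

/-- **Stub (v7-3, the ball has transcendental volume).** For `d ≥ 2` the Lebesgue volume of the
open unit ball `B_d = {∑ zᵢ² < 1} ⊆ ℝᵈ` — `π^{d/2}/Γ(d/2 + 1)`, a non-zero rational multiple of
`π^{⌊d/2⌋}` — is transcendental: Lindemann's theorem (`transcendental_pi_holds`, proved in the
tree) and `ℚ̄` a field. [Lindemann 1882; Mathlib `EuclideanSpace.volume_ball`] [folklore] -/
theorem stub_ballVolumeTranscendental : ∀ d : ℕ, 2 ≤ d →
    Transcendental ℚ (volume {z : Fin d → ℝ | ∑ i, (z i) ^ 2 < 1}).toReal := by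
  sorry

/-- **Stub (v7-4, SUBGRAPH TO BASE: one Newton–Leibniz move).** For a `ℚ`-semialgebraic function
`f ≥ 0` on the domain of `r'`, the integrand-`1` representation `r` on the closed subgraph band
`{(x, t) | x ∈ r'.domain, 0 ≤ t ≤ f x}` and the base representation `r' = [r'.domain, f]` differ by
ONE move of rule (3): primitive `F(x, t) = t`, bounds `a = 0 ≤ b = f`, `F(x, f x) − F(x, 0) = f x`.
[Kontsevich–Zagier 2001, §1.2 rule (3)] [folklore] -/
theorem stub_subgraphToBase : ∀ (n : ℕ) (r : KZ.IntegralRep (n + 1)) (r' : KZ.IntegralRep n)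
    (f : (Fin n → ℝ) → ℝ),
    IsSemialgebraicFunOn ℚ r'.domain f → (∀ x ∈ r'.domain, 0 ≤ f x) →
    r.domain = {z : Fin (n + 1) → ℝ | (Fin.init z : Fin n → ℝ) ∈ r'.domain ∧ 0 ≤ z (Fin.last n) ∧
        z (Fin.last n) ≤ f (Fin.init z)} →
    (∀ z ∈ r.domain, r.integrand z = 1) → (∀ x ∈ r'.domain, r'.integrand x = f x) →
    KZ.of r - KZ.of r' ∈ KZ.relations := by
  sorry

/-- **Stub (v7-5, THE SIMPLEX IS A K-CELL: `[Δ_d, 1] ≡ [pt, 1/d!]`).** The integrand-`1`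
representation on the open corner simplex `Δ_d = {x > 0, ∑ xᵢ < 1}` differs by relations from the
point `[pt, 1/d!]`: Dirichlet peeling `D_{m+1}(1; c) ∼ D_m(1; c+1) × β(1, c)`
(`KZ.dirichletPeel_equivalent`, one rule-(2) move each), `β(1, c) ∼ [pt, 1/c]`
(`KZ.betaOne_equivalent_unit_constMul`), products of points are points, and `D_0 = [pt, 1]`.
[Andrews–Askey–Roy 1999, Thm 1.8.1; Kontsevich–Zagier 2001, §1.2] [folklore] -/
theorem stub_simplexCell : ∀ (d : ℕ) (ρ : KZ.IntegralRep d),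
    ρ.domain = {x : Fin d → ℝ | (∀ i, 0 < x i) ∧ ∑ i, x i < 1} →
    (∀ x ∈ ρ.domain, ρ.integrand x = 1) →
    ∀ hv : IsAlgebraic ℚ ((Nat.factorial d : ℝ)⁻¹),
      KZ.of ρ - KZ.of (KZ.IntegralRep.unit.constMul ((Nat.factorial d : ℝ)⁻¹) hv) ∈
        KZ.relations := by
  sorry

/-- **Stub (v7-6, lead: A POLYNOMIAL OVER A RATIONAL BOX IS A K-CELL).** A representation on
the open rational box `{aᵢ < xᵢ < bᵢ}` whose integrand is a polynomial with rational coefficients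
differs by relations from a point `[pt, v]`, `v` real algebraic (indeed `v = ∫ p ∈ ℚ`): one affine
rule-(2) move to the unit cube, the null boundary, the tree's cube polynomial kernel
(`KZ.RFun.poly_rep_mem_relations_of_integral_eq_zero`: `[[0,1]^d, p − ∫p] ∈ relations`) and the
lift of constants `[[0,1]^d, c] ≡ [pt, c]` (`KZ.RFun.rel_liftN`).
[Kontsevich–Zagier 2001, §1.2] [folklore] -/
theorem stub_polynomialBoxCell : ∀ (d : ℕ) (a b : Fin d → ℚ) (p : MvPolynomial (Fin d) ℚ)
    (ρ : KZ.IntegralRep d),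
    (∀ i, a i < b i) → ρ.domain = {x : Fin d → ℝ | ∀ i, (a i : ℝ) < x i ∧ x i < (b i : ℝ)} →
    (∀ x ∈ ρ.domain, ρ.integrand x = MvPolynomial.aeval x p) →
    ∃ (v : ℝ) (hv : IsAlgebraic ℚ v),
      KZ.of ρ - KZ.of (KZ.IntegralRep.unit.constMul v hv) ∈ KZ.relations := by
  sorry

/-- **Stub (CONCEDED residual: the frame in dimensions `N ≥ 3`, given the two sectors).**
Summit-strength by the kernel-checked equivalence `VolumeFormOffPlane ↔ VolumeForm ↔
KontsevichZagierPeriods` (`Theorems/VolumeFormOffPlane/Negative/Core.lean`); the line does not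
claim it. It is stated GIVEN the proved sectors: rank-two toric boxes (all dimensions), polygon cells
(dimension `3`), simplex/box and binomial-cell families (all dimensions), the two pair forms, and
(v6) the signed scissors layer, the corner cut and the slack merge, the certificate classes, the
overlapping box unions, and the Euclidean affine-orbit sector (algebraic simplices, boxes, bevelled
boxes, ellipsoids), which is what this line proves unconditionally.
[cite: CressonViusos2022, Problem 2.1] -/
theorem stub_frameHighResidual : (∀ (n : ℕ) (α β : ℝ), 0 < α → 0 < β → IsAlgebraic ℚ α → IsAlgebraic ℚ β → (∀ p q : ℤ, α ^ p * β ^ q = 1 → p = 0 ∧ q = 0) → ∀ (k k' : ℕ) (u v u₁ v₁ : Fin k → Fin n → ℤ) (s t s₁ t₁ : Fin k' → Fin n → ℤ) (r : Fin k → KZ.IntegralRep (n + 1)) (r' : Fin k' → KZ.IntegralRep (n + 1)), (∀ i j, α ^ u i j * β ^ v i j < α ^ u₁ i j * β ^ v₁ i j) → (∀ i j, α ^ s i j * β ^ t i j < α ^ s₁ i j * β ^ t₁ i j) → (∀ i, (r i).domain = {p : Fin (n + 1) → ℝ | (∀ j : Fin n, α ^ u i j * β ^ v i j < p (Fin.castSucc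 j) ∧ p (Fin.castSucc j) < α ^ u₁ i j * β ^ v₁ i j) ∧ 0 < p (Fin.last n) ∧ p (Fin.last n) * ∏ j : Fin n, p (Fin.castSucc j) < 1}) → (∀ i, ∀ p ∈ (r i).domain, (r i).integrand p = 1) → (∀ i, (r' i).domain = {p : Fin (n + 1) → ℝ | (∀ j : Fin n, α ^ s i j * β ^ t i j < p (Fin.castSucc j) ∧ p (Fin.castSucc j) < α ^ s₁ i j * β ^ t₁ i j) ∧ 0 < p (Fin.last n) ∧ p (Fin.last n) * ∏ j : Fin n, p (Fin.castSucc j) < 1}) → (∀ i, ∀ p ∈ (r' i).domain, (r' i).integrand p = 1) → ∑ i, (r i).value = ∑ i, (r' i).value → ∑ i, KZ.of (r i) - ∑ i, KZ.of (r' i) ∈ KZ.relations) → (∀ (α β : ℝ), 0 < α → 0 < β → IsAlgebraic ℚ α → IsAlgebraic ℚ β → (∀ p q : ℤ, α ^ p * β ^ q = 1 → p = 0 ∧ q = 0) → ∀ (k m k' m' : ℕ) (a : Fin k → Fin 2 → ℝ) (u v : Fin k → Fin 2 → ℚ) (ta tb tc : Fin m → ℝ) (ti tj : Fin m → ℕ)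 (tu tv : Fin m → ℚ) (a' : Fin k' → Fin 2 → ℝ) (u' v' : Fin k' → Fin 2 → ℚ) (ta' tb' tc' : Fin m' → ℝ) (ti' tj' : Fin m' → ℕ) (tu' tv' : Fin m' → ℚ) (rB : Fin k → KZ.IntegralRep 3) (rT : Fin m → KZ.IntegralRep 3) (rB' : Fin k' → KZ.IntegralRep 3) (rT' : Fin m' → KZ.IntegralRep 3), (∀ i j, 0 < a i j) → (∀ i j, IsAlgebraic ℚ (a i j)) → (∀ i j, 1 < α ^ ((u i j : ℚ) : ℝ) * β ^ ((v i j : ℚ) : ℝ)) → (∀ i, (rB i).domain = {p : Fin (2 + 1) → ℝ | (∀ j : Fin 2, a i j < p (Fin.castSucc j) ∧ p (Fin.castSucc j) < a i j * (α ^ ((u i j : ℚ) : ℝ) * β ^ ((v i j : ℚ) : ℝ))) ∧ 0 < p (Fin.last 2) ∧ p (Fin.last 2) * ∏ j : Fin 2, p (Fin.castSucc j) < 1}) → (∀ i, ∀ p ∈ (rB i).domain, (rB i).integrand p = 1) → (∀ ν, 0 < ta ν) → (∀ ν, 0 < tb ν) → (∀ ν, IsAlgebraic ℚ (ta ν)) →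 (∀ ν, IsAlgebraic ℚ (tb ν)) → (∀ ν, IsAlgebraic ℚ (tc ν)) → (∀ ν, 1 ≤ ti ν) → (∀ ν, 1 ≤ tj ν) → (∀ ν, tc ν = ta ν ^ ti ν * tb ν ^ tj ν * (α ^ ((tu ν : ℚ) : ℝ) * β ^ ((tv ν : ℚ) : ℝ))) → (∀ ν, 1 < α ^ ((tu ν : ℚ) : ℝ) * β ^ ((tv ν : ℚ) : ℝ)) → (∀ ν, (rT ν).domain = {p : Fin 3 → ℝ | ta ν < p 0 ∧ tb ν < p 1 ∧ p 0 ^ ti ν * p 1 ^ tj ν < tc ν ∧ 0 < p 2 ∧ p 2 * (p 0 * p 1) < 1}) → (∀ ν, ∀ p ∈ (rT ν).domain, (rT ν).integrand p = 1) → (∀ i j, 0 < a' i j) → (∀ i j, IsAlgebraic ℚ (a' i j)) → (∀ i j, 1 < α ^ ((u' i j : ℚ) : ℝ) * β ^ ((v' i j : ℚ) : ℝ)) → (∀ i, (rB' i).domain = {p : Fin (2 + 1) → ℝ | (∀ j : Fin 2, a' i j < p (Fin.castSucc j) ∧ p (Fin.castSucc j) < a' i j * (α ^ ((u' i j : ℚ)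 : ℝ) * β ^ ((v' i j : ℚ) : ℝ))) ∧ 0 < p (Fin.last 2) ∧ p (Fin.last 2) * ∏ j : Fin 2, p (Fin.castSucc j) < 1}) → (∀ i, ∀ p ∈ (rB' i).domain, (rB' i).integrand p = 1) → (∀ ν, 0 < ta' ν) → (∀ ν, 0 < tb' ν) → (∀ ν, IsAlgebraic ℚ (ta' ν)) → (∀ ν, IsAlgebraic ℚ (tb' ν)) → (∀ ν, IsAlgebraic ℚ (tc' ν)) → (∀ ν, 1 ≤ ti' ν) → (∀ ν, 1 ≤ tj' ν) → (∀ ν, tc' ν = ta' ν ^ ti' ν * tb' ν ^ tj' ν * (α ^ ((tu' ν : ℚ) : ℝ) * β ^ ((tv' ν : ℚ) : ℝ))) → (∀ ν, 1 < α ^ ((tu' ν : ℚ) : ℝ) * β ^ ((tv' ν : ℚ) : ℝ)) → (∀ ν, (rT' ν).domain = {p : Fin 3 → ℝ | ta' ν < p 0 ∧ tb' ν < p 1 ∧ p 0 ^ ti' ν * p 1 ^ tj' ν < tc' ν ∧ 0 < p 2 ∧ p 2 * (p 0 * p 1) < 1}) → (∀ ν, ∀ p ∈ (rT' ν).domain,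 (rT' ν).integrand p = 1) → ∑ ν, (rB ν).value + ∑ ν, (rT ν).value = ∑ ν, (rB' ν).value + ∑ ν, (rT' ν).value → (∑ ν, KZ.of (rB ν) + ∑ ν, KZ.of (rT ν)) - (∑ ν, KZ.of (rB' ν) + ∑ ν, KZ.of (rT' ν)) ∈ KZ.relations) → (∀ (n : ℕ) (α β : ℝ), 0 < α → 0 < β → IsAlgebraic ℚ α → IsAlgebraic ℚ β → (∀ p q : ℤ, α ^ p * β ^ q = 1 → p = 0 ∧ q = 0) → ∀ (k m k' m' : ℕ) (a : Fin k → Fin (n + 1) → ℝ) (u v : Fin k → Fin (n + 1) → ℚ) (sa : Fin m → Fin (n + 1) → ℝ) (sc : Fin m → ℝ) (su sv : Fin m → ℚ) (a' : Fin k' → Fin (n + 1) → ℝ) (u' v' : Fin k' → Fin (n + 1) → ℚ) (sa' : Fin m' → Fin (n + 1) → ℝ) (sc' : Fin m' → ℝ) (su' sv' : Fin m' → ℚ) (rB : Fin k → KZ.IntegralRep (n + 1 + 1)) (rS : Fin m → KZ.IntegralRep (n + 1 + 1)) (rB' : Fin k' → KZ.IntegralRep (n + 1 + 1)) (rS' :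 Fin m' → KZ.IntegralRep (n + 1 + 1)), (∀ i j, 0 < a i j) → (∀ i j, IsAlgebraic ℚ (a i j)) → (∀ i j, 1 < α ^ ((u i j : ℚ) : ℝ) * β ^ ((v i j : ℚ) : ℝ)) → (∀ i, (rB i).domain = {p : Fin (n + 1 + 1) → ℝ | (∀ j : Fin (n + 1), a i j < p (Fin.castSucc j) ∧ p (Fin.castSucc j) < a i j * (α ^ ((u i j : ℚ) : ℝ) * β ^ ((v i j : ℚ) : ℝ))) ∧ 0 < p (Fin.last (n + 1)) ∧ p (Fin.last (n + 1)) * ∏ j : Fin (n + 1), p (Fin.castSucc j) < 1}) → (∀ i, ∀ p ∈ (rB i).domain, (rB i).integrand p = 1) → (∀ ν ι, 0 < sa ν ι) → (∀ ν ι, IsAlgebraic ℚ (sa ν ι)) → (∀ ν, IsAlgebraic ℚ (sc ν)) → (∀ ν, sc ν = (∏ ι, sa ν ι) * (α ^ ((su ν : ℚ) : ℝ) * β ^ ((sv ν : ℚ) : ℝ))) → (∀ ν, 1 < α ^ ((su ν : ℚ) : ℝ) * β ^ ((sv ν : ℚ) : ℝ)) → (∀ ν, (rS ν).domain = {p : Fin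 ((n + 1) + 1) → ℝ | (∀ ι : Fin (n + 1), (sa ν) ι < p (Fin.castSucc ι)) ∧ ∏ ι : Fin (n + 1), p (Fin.castSucc ι) < sc ν ∧ 0 < p (Fin.last (n + 1)) ∧ p (Fin.last (n + 1)) * ∏ ι : Fin (n + 1), p (Fin.castSucc ι) < 1}) → (∀ ν, ∀ p ∈ (rS ν).domain, (rS ν).integrand p = 1) → (∀ i j, 0 < a' i j) → (∀ i j, IsAlgebraic ℚ (a' i j)) → (∀ i j, 1 < α ^ ((u' i j : ℚ) : ℝ) * β ^ ((v' i j : ℚ) : ℝ)) → (∀ i, (rB' i).domain = {p : Fin (n + 1 + 1) → ℝ | (∀ j : Fin (n + 1), a' i j < p (Fin.castSucc j) ∧ p (Fin.castSucc j) < a' i j * (α ^ ((u' i j : ℚ) : ℝ) * β ^ ((v' i j : ℚ) : ℝ))) ∧ 0 < p (Fin.last (n + 1)) ∧ p (Fin.last (n + 1)) * ∏ j : Fin (n + 1), p (Fin.castSucc j) < 1}) → (∀ i, ∀ p ∈ (rB' i).domain, (rB' i).integrand p = 1) → (∀ ν ι, 0 < sa' ν ι) → (∀ ν ι, IsAlgebraic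 ℚ (sa' ν ι)) → (∀ ν, IsAlgebraic ℚ (sc' ν)) → (∀ ν, sc' ν = (∏ ι, sa' ν ι) * (α ^ ((su' ν : ℚ) : ℝ) * β ^ ((sv' ν : ℚ) : ℝ))) → (∀ ν, 1 < α ^ ((su' ν : ℚ) : ℝ) * β ^ ((sv' ν : ℚ) : ℝ)) → (∀ ν, (rS' ν).domain = {p : Fin ((n + 1) + 1) → ℝ | (∀ ι : Fin (n + 1), (sa' ν) ι < p (Fin.castSucc ι)) ∧ ∏ ι : Fin (n + 1), p (Fin.castSucc ι) < sc' ν ∧ 0 < p (Fin.last (n + 1)) ∧ p (Fin.last (n + 1)) * ∏ ι : Fin (n + 1), p (Fin.castSucc ι) < 1}) → (∀ ν, ∀ p ∈ (rS' ν).domain, (rS' ν).integrand p = 1) → ∑ ν, (rB ν).value + ∑ ν, (rS ν).value = ∑ ν, (rB' ν).value + ∑ ν, (rS' ν).value → (∑ ν, KZ.of (rB ν) + ∑ ν, KZ.of (rS ν)) - (∑ ν, KZ.of (rB' ν) + ∑ ν, KZ.of (rS' ν)) ∈ KZ.relations) → (∀ (n : ℕ) (α β : ℝ), 0 < α → 0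 < β → IsAlgebraic ℚ α → IsAlgebraic ℚ β → (∀ p q : ℤ, α ^ p * β ^ q = 1 → p = 0 ∧ q = 0) → ∀ (k m k' m' : ℕ) (a : Fin k → Fin (n + 1) → ℝ) (u v : Fin k → Fin (n + 1) → ℚ) (sM : Fin m → Matrix (Fin (n + 1)) (Fin (n + 1)) ℤ) (sa : Fin m → Fin (n + 1) → ℝ) (sc : Fin m → ℝ) (su sv : Fin m → ℚ) (a' : Fin k' → Fin (n + 1) → ℝ) (u' v' : Fin k' → Fin (n + 1) → ℚ) (sM' : Fin m' → Matrix (Fin (n + 1)) (Fin (n + 1)) ℤ) (sa' : Fin m' → Fin (n + 1) → ℝ) (sc' : Fin m' → ℝ) (su' sv' : Fin m' → ℚ) (rB : Fin k → KZ.IntegralRep (n + 1 + 1)) (rS : Fin m → KZ.IntegralRep (n + 1 + 1)) (rB' : Fin k' → KZ.IntegralRep (n + 1 + 1)) (rS' : Fin m' → KZ.IntegralRep (n + 1 + 1)), (∀ i j, 0 < a i j) → (∀ i j, IsAlgebraic ℚ (a i j)) → (∀ i j, 1 < α ^ ((u i j : ℚ) : ℝ) * β ^ ((v i j : ℚ)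 : ℝ)) → (∀ i, (rB i).domain = {p : Fin (n + 1 + 1) → ℝ | (∀ j : Fin (n + 1), a i j < p (Fin.castSucc j) ∧ p (Fin.castSucc j) < a i j * (α ^ ((u i j : ℚ) : ℝ) * β ^ ((v i j : ℚ) : ℝ))) ∧ 0 < p (Fin.last (n + 1)) ∧ p (Fin.last (n + 1)) * ∏ j : Fin (n + 1), p (Fin.castSucc j) < 1}) → (∀ i, ∀ p ∈ (rB i).domain, (rB i).integrand p = 1) → (∀ ν, ((sM) ν).det ≠ 0) → (∀ ν ι, 0 < sa ν ι) → (∀ ν ι, IsAlgebraic ℚ (sa ν ι)) → (∀ ν, IsAlgebraic ℚ (sc ν)) → (∀ ν, sc ν = (∏ ι, sa ν ι) * (α ^ ((su ν : ℚ) : ℝ) * β ^ ((sv ν : ℚ) : ℝ))) → (∀ ν, 1 < α ^ ((su ν : ℚ) : ℝ) * β ^ ((sv ν : ℚ) : ℝ)) → (∀ ν, (rS ν).domain = {p : Fin ((n + 1) + 1) → ℝ | (∀ ι : Fin (n + 1), 0 < p (Fin.castSucc ι)) ∧ (∀ k : Fin (n + 1), (sa ν) k < ∏ j : Fin (n + 1),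 p (Fin.castSucc j) ^ (sM ν k j)) ∧ ∏ k : Fin (n + 1), ∏ j : Fin (n + 1), p (Fin.castSucc j) ^ (sM ν k j) < sc ν ∧ 0 < p (Fin.last (n + 1)) ∧ p (Fin.last (n + 1)) * ∏ ι : Fin (n + 1), p (Fin.castSucc ι) < 1}) → (∀ ν, ∀ p ∈ (rS ν).domain, (rS ν).integrand p = 1) → (∀ i j, 0 < a' i j) → (∀ i j, IsAlgebraic ℚ (a' i j)) → (∀ i j, 1 < α ^ ((u' i j : ℚ) : ℝ) * β ^ ((v' i j : ℚ) : ℝ)) → (∀ i, (rB' i).domain = {p : Fin (n + 1 + 1) → ℝ | (∀ j : Fin (n + 1), a' i j < p (Fin.castSucc j) ∧ p (Fin.castSucc j) < a' i j * (α ^ ((u' i j : ℚ) : ℝ) * β ^ ((v' i j : ℚ) : ℝ))) ∧ 0 < p (Fin.last (n + 1)) ∧ p (Fin.last (n + 1)) * ∏ j : Fin (n + 1), p (Fin.castSucc j) < 1}) → (∀ i, ∀ p ∈ (rB' i).domain, (rB' i).integrand p = 1) → (∀ ν, ((sM') ν).det ≠ 0) → (∀ ν ι, 0 < sa' ν ι)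 → (∀ ν ι, IsAlgebraic ℚ (sa' ν ι)) → (∀ ν, IsAlgebraic ℚ (sc' ν)) → (∀ ν, sc' ν = (∏ ι, sa' ν ι) * (α ^ ((su' ν : ℚ) : ℝ) * β ^ ((sv' ν : ℚ) : ℝ))) → (∀ ν, 1 < α ^ ((su' ν : ℚ) : ℝ) * β ^ ((sv' ν : ℚ) : ℝ)) → (∀ ν, (rS' ν).domain = {p : Fin ((n + 1) + 1) → ℝ | (∀ ι : Fin (n + 1), 0 < p (Fin.castSucc ι)) ∧ (∀ k : Fin (n + 1), (sa' ν) k < ∏ j : Fin (n + 1), p (Fin.castSucc j) ^ (sM' ν k j)) ∧ ∏ k : Fin (n + 1), ∏ j : Fin (n + 1), p (Fin.castSucc j) ^ (sM' ν k j) < sc' ν ∧ 0 < p (Fin.last (n + 1)) ∧ p (Fin.last (n + 1)) * ∏ ι : Fin (n + 1), p (Fin.castSucc ι) < 1}) → (∀ ν, ∀ p ∈ (rS' ν).domain, (rS' ν).integrand p = 1) → ∑ ν, (rB ν).value + ∑ ν, (rS ν).value = ∑ ν, (rB' ν).value + ∑ ν, (rS' ν).value → (∑ ν, KZ.of (rB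 ν) + ∑ ν, KZ.of (rS ν)) - (∑ ν, KZ.of (rB' ν) + ∑ ν, KZ.of (rS' ν)) ∈ KZ.relations) → (∀ (n : ℕ) (α β : ℝ), 0 < α → 0 < β → IsAlgebraic ℚ α → IsAlgebraic ℚ β → (∀ p q : ℤ, α ^ p * β ^ q = 1 → p = 0 ∧ q = 0) → ∀ (k m k' m' : ℕ) (a : Fin k → Fin (n + 1) → ℝ) (u v : Fin k → Fin (n + 1) → ℚ) (sa : Fin m → Fin (n + 1) → ℝ) (sc : Fin m → ℝ) (su sv : Fin m → ℚ) (a' : Fin k' → Fin (n + 1) → ℝ) (u' v' : Fin k' → Fin (n + 1) → ℚ) (sa' : Fin m' → Fin (n + 1) → ℝ) (sc' : Fin m' → ℝ) (su' sv' : Fin m' → ℚ) (rB : Fin k → KZ.IntegralRep (n + 1 + 1)) (rS : Fin m → KZ.IntegralRep (n + 1 + 1)) (rB' : Fin k' → KZ.IntegralRep (n + 1 + 1)) (rS' : Fin m' → KZ.IntegralRep (n + 1 + 1)) (r r' : KZ.IntegralRep (n + 1 + 1)), (∀ i j, 0 < a i j) → (∀ i j, IsAlgebraic ℚ (a i j))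 → (∀ i j, 1 < α ^ ((u i j : ℚ) : ℝ) * β ^ ((v i j : ℚ) : ℝ)) → (∀ i, (rB i).domain = {p : Fin (n + 1 + 1) → ℝ | (∀ j : Fin (n + 1), a i j < p (Fin.castSucc j) ∧ p (Fin.castSucc j) < a i j * (α ^ ((u i j : ℚ) : ℝ) * β ^ ((v i j : ℚ) : ℝ))) ∧ 0 < p (Fin.last (n + 1)) ∧ p (Fin.last (n + 1)) * ∏ j : Fin (n + 1), p (Fin.castSucc j) < 1}) → (∀ i, ∀ p ∈ (rB i).domain, (rB i).integrand p = 1) → (∀ ν ι, 0 < sa ν ι) → (∀ ν ι, IsAlgebraic ℚ (sa ν ι)) → (∀ ν, IsAlgebraic ℚ (sc ν)) → (∀ ν, sc ν = (∏ ι, sa ν ι) * (α ^ ((su ν : ℚ) : ℝ) * β ^ ((sv ν : ℚ) : ℝ))) → (∀ ν, 1 < α ^ ((su ν : ℚ) : ℝ) * β ^ ((sv ν : ℚ) : ℝ)) → (∀ ν, (rS ν).domain = {p : Fin ((n + 1) + 1) → ℝ | (∀ ι : Fin (n + 1), (sa ν) ι < p (Fin.castSucc ι)) ∧ ∏ ι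 : Fin (n + 1), p (Fin.castSucc ι) < sc ν ∧ 0 < p (Fin.last (n + 1)) ∧ p (Fin.last (n + 1)) * ∏ ι : Fin (n + 1), p (Fin.castSucc ι) < 1}) → (∀ ν, ∀ p ∈ (rS ν).domain, (rS ν).integrand p = 1) → (∀ i j, 0 < a' i j) → (∀ i j, IsAlgebraic ℚ (a' i j)) → (∀ i j, 1 < α ^ ((u' i j : ℚ) : ℝ) * β ^ ((v' i j : ℚ) : ℝ)) → (∀ i, (rB' i).domain = {p : Fin (n + 1 + 1) → ℝ | (∀ j : Fin (n + 1), a' i j < p (Fin.castSucc j) ∧ p (Fin.castSucc j) < a' i j * (α ^ ((u' i j : ℚ) : ℝ) * β ^ ((v' i j : ℚ) : ℝ))) ∧ 0 < p (Fin.last (n + 1)) ∧ p (Fin.last (n + 1)) * ∏ j : Fin (n + 1), p (Fin.castSucc j) < 1}) → (∀ i, ∀ p ∈ (rB' i).domain, (rB' i).integrand p = 1) → (∀ ν ι, 0 < sa' ν ι) → (∀ ν ι, IsAlgebraic ℚ (sa' ν ι)) → (∀ ν, IsAlgebraic ℚ (sc' ν)) → (∀ ν, sc' ν = (∏ ι,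 sa' ν ι) * (α ^ ((su' ν : ℚ) : ℝ) * β ^ ((sv' ν : ℚ) : ℝ))) → (∀ ν, 1 < α ^ ((su' ν : ℚ) : ℝ) * β ^ ((sv' ν : ℚ) : ℝ)) → (∀ ν, (rS' ν).domain = {p : Fin ((n + 1) + 1) → ℝ | (∀ ι : Fin (n + 1), (sa' ν) ι < p (Fin.castSucc ι)) ∧ ∏ ι : Fin (n + 1), p (Fin.castSucc ι) < sc' ν ∧ 0 < p (Fin.last (n + 1)) ∧ p (Fin.last (n + 1)) * ∏ ι : Fin (n + 1), p (Fin.castSucc ι) < 1}) → (∀ ν, ∀ p ∈ (rS' ν).domain, (rS' ν).integrand p = 1) → r.domain = (⋃ i, (rB i).domain) ∪ (⋃ ν, (rS ν).domain) → (∀ i j, i ≠ j → Disjoint ((rB) i).domain ((rB) j).domain) → (∀ ν μ, ν ≠ μ → Disjoint ((rS) ν).domain ((rS) μ).domain) → (∀ i ν, Disjoint ((rB) i).domain ((rS) ν).domain) → (∀ p ∈ r.domain, r.integrand p = 1) → r'.domain = (⋃ i, (rB' i).domain) ∪ (⋃ ν, (rS' ν).domain) → (∀ i j, i ≠ j → Disjoint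 ((rB') i).domain ((rB') j).domain) → (∀ ν μ, ν ≠ μ → Disjoint ((rS') ν).domain ((rS') μ).domain) → (∀ i ν, Disjoint ((rB') i).domain ((rS') ν).domain) → (∀ p ∈ r'.domain, r'.integrand p = 1) → r.value = r'.value → KZ.Equivalent r r') → (∀ (α β : ℝ), 0 < α → 0 < β → IsAlgebraic ℚ α → IsAlgebraic ℚ β → (∀ p q : ℤ, α ^ p * β ^ q = 1 → p = 0 ∧ q = 0) → ∀ (k m k' m' : ℕ) (a : Fin k → Fin 2 → ℝ) (u v : Fin k → Fin 2 → ℚ) (ta tb tc : Fin m → ℝ) (ti tj : Fin m → ℕ) (tu tv : Fin m → ℚ) (a' : Fin k' → Fin 2 → ℝ) (u' v' : Fin k' → Fin 2 → ℚ) (ta' tb' tc' : Fin m' → ℝ) (ti' tj' : Fin m' → ℕ) (tu' tv' : Fin m' → ℚ) (rB : Fin k → KZ.IntegralRep 3) (rT : Fin m → KZ.IntegralRep 3) (rB' : Fin k' → KZ.IntegralRep 3) (rT' : Fin m' → KZ.IntegralRep 3) (r r' : KZ.IntegralRep 3), (∀ i j, 0 < a i j) → (∀ i j, IsAlgebraic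 ℚ (a i j)) → (∀ i j, 1 < α ^ ((u i j : ℚ) : ℝ) * β ^ ((v i j : ℚ) : ℝ)) → (∀ i, (rB i).domain = {p : Fin (2 + 1) → ℝ | (∀ j : Fin 2, a i j < p (Fin.castSucc j) ∧ p (Fin.castSucc j) < a i j * (α ^ ((u i j : ℚ) : ℝ) * β ^ ((v i j : ℚ) : ℝ))) ∧ 0 < p (Fin.last 2) ∧ p (Fin.last 2) * ∏ j : Fin 2, p (Fin.castSucc j) < 1}) → (∀ i, ∀ p ∈ (rB i).domain, (rB i).integrand p = 1) → (∀ ν, 0 < ta ν) → (∀ ν, 0 < tb ν) → (∀ ν, IsAlgebraic ℚ (ta ν)) → (∀ ν, IsAlgebraic ℚ (tb ν)) → (∀ ν, IsAlgebraic ℚ (tc ν)) → (∀ ν, 1 ≤ ti ν) → (∀ ν, 1 ≤ tj ν) → (∀ ν, tc ν = ta ν ^ ti ν * tb ν ^ tj ν * (α ^ ((tu ν : ℚ) : ℝ) * β ^ ((tv ν : ℚ) : ℝ))) → (∀ ν, 1 < α ^ ((tu ν : ℚ) : ℝ) * β ^ ((tv ν : ℚ) : ℝ)) → (∀ ν, (rT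 ν).domain = {p : Fin 3 → ℝ | ta ν < p 0 ∧ tb ν < p 1 ∧ p 0 ^ ti ν * p 1 ^ tj ν < tc ν ∧ 0 < p 2 ∧ p 2 * (p 0 * p 1) < 1}) → (∀ ν, ∀ p ∈ (rT ν).domain, (rT ν).integrand p = 1) → (∀ i j, 0 < a' i j) → (∀ i j, IsAlgebraic ℚ (a' i j)) → (∀ i j, 1 < α ^ ((u' i j : ℚ) : ℝ) * β ^ ((v' i j : ℚ) : ℝ)) → (∀ i, (rB' i).domain = {p : Fin (2 + 1) → ℝ | (∀ j : Fin 2, a' i j < p (Fin.castSucc j) ∧ p (Fin.castSucc j) < a' i j * (α ^ ((u' i j : ℚ) : ℝ) * β ^ ((v' i j : ℚ) : ℝ))) ∧ 0 < p (Fin.last 2) ∧ p (Fin.last 2) * ∏ j : Fin 2, p (Fin.castSucc j) < 1}) → (∀ i, ∀ p ∈ (rB' i).domain, (rB' i).integrand p = 1) → (∀ ν, 0 < ta' ν) → (∀ ν, 0 < tb' ν) → (∀ ν, IsAlgebraic ℚ (ta' ν)) → (∀ ν, IsAlgebraic ℚ (tb' ν)) → (∀ ν, IsAlgebraic ℚ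 (tc' ν)) → (∀ ν, 1 ≤ ti' ν) → (∀ ν, 1 ≤ tj' ν) → (∀ ν, tc' ν = ta' ν ^ ti' ν * tb' ν ^ tj' ν * (α ^ ((tu' ν : ℚ) : ℝ) * β ^ ((tv' ν : ℚ) : ℝ))) → (∀ ν, 1 < α ^ ((tu' ν : ℚ) : ℝ) * β ^ ((tv' ν : ℚ) : ℝ)) → (∀ ν, (rT' ν).domain = {p : Fin 3 → ℝ | ta' ν < p 0 ∧ tb' ν < p 1 ∧ p 0 ^ ti' ν * p 1 ^ tj' ν < tc' ν ∧ 0 < p 2 ∧ p 2 * (p 0 * p 1) < 1}) → (∀ ν, ∀ p ∈ (rT' ν).domain, (rT' ν).integrand p = 1) → r.domain = (⋃ i, (rB i).domain) ∪ (⋃ ν, (rT ν).domain) → (∀ i j, i ≠ j → Disjoint ((rB) i).domain ((rB) j).domain) → (∀ ν μ, ν ≠ μ → Disjoint ((rT) ν).domain ((rT) μ).domain) → (∀ i ν, Disjoint ((rB) i).domain ((rT) ν).domain) → (∀ p ∈ r.domain, r.integrand p = 1) → r'.domain = (⋃ i, (rB' i).domain) ∪ (⋃ ν, (rT' ν).domain)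 → (∀ i j, i ≠ j → Disjoint ((rB') i).domain ((rB') j).domain) → (∀ ν μ, ν ≠ μ → Disjoint ((rT') ν).domain ((rT') μ).domain) → (∀ i ν, Disjoint ((rB') i).domain ((rT') ν).domain) → (∀ p ∈ r'.domain, r'.integrand p = 1) → r.value = r'.value → KZ.Equivalent r r') →
    (∀ (N k : ℕ) (ρ : Fin k → KZ.IntegralRep N) (ε : Fin k → ℤ),
      (∀ i, ∀ x ∈ (ρ i).domain, (ρ i).integrand x = 1) →
      (∀ᵐ x : Fin N → ℝ, ∑ i, (ε i : ℝ) * (ρ i).domain.indicator (fun _ => (1 : ℝ)) x = 0) →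
      ∑ i, ε i • KZ.of (ρ i) ∈ KZ.relations) →
    (∀ (N : ℕ) (GB GS : KZ.IntegralRep N → Prop),
      (∀ (k m k' m' : ℕ) (ρB : Fin k → KZ.IntegralRep N) (ρS : Fin m → KZ.IntegralRep N)
      (ρB' : Fin k' → KZ.IntegralRep N) (ρS' : Fin m' → KZ.IntegralRep N),
      (∀ i, GB (ρB i)) → (∀ ν, GS (ρS ν)) → (∀ i, GB (ρB' i)) → (∀ ν, GS (ρS' ν)) →
      ∑ i, (ρB i).value + ∑ ν, (ρS ν).value = ∑ i, (ρB' i).value + ∑ ν, (ρS' ν).value →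
      (∑ i, KZ.of (ρB i) + ∑ ν, KZ.of (ρS ν)) - (∑ i, KZ.of (ρB' i) + ∑ ν, KZ.of (ρS' ν)) ∈
      KZ.relations) →
      ∀ (k m : ℕ) (ρB : Fin k → KZ.IntegralRep N) (ρS : Fin m → KZ.IntegralRep N)
      (cB : Fin k → ℤ) (cS : Fin m → ℤ),
      (∀ i, cB i ≠ 0 → GB (ρB i)) → (∀ ν, cS ν ≠ 0 → GS (ρS ν)) →
      ∑ i, (cB i : ℝ) * (ρB i).value + ∑ ν, (cS ν : ℝ) * (ρS ν).value = 0 →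
      ∑ i, cB i • KZ.of (ρB i) + ∑ ν, cS ν • KZ.of (ρS ν) ∈ KZ.relations) →
    (∀ (N : ℕ) (GB GS : KZ.IntegralRep N → Prop),
      (∀ (k : ℕ) (ρ : Fin k → KZ.IntegralRep N) (ε : Fin k → ℤ),
      (∀ i, ∀ x ∈ (ρ i).domain, (ρ i).integrand x = 1) →
      (∀ᵐ x : Fin N → ℝ, ∑ i, (ε i : ℝ) * (ρ i).domain.indicator (fun _ => (1 : ℝ)) x = 0) →
      ∑ i, ε i • KZ.of (ρ i) ∈ KZ.relations) →
      (∀ (k m : ℕ) (ρB : Fin k → KZ.IntegralRep N) (ρS : Fin m → KZ.IntegralRep N)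
      (cB : Fin k → ℤ) (cS : Fin m → ℤ),
      (∀ i, cB i ≠ 0 → GB (ρB i)) → (∀ ν, cS ν ≠ 0 → GS (ρS ν)) →
      ∑ i, (cB i : ℝ) * (ρB i).value + ∑ ν, (cS ν : ℝ) * (ρS ν).value = 0 →
      ∑ i, cB i • KZ.of (ρB i) + ∑ ν, cS ν • KZ.of (ρS ν) ∈ KZ.relations) →
      ∀ (r r' : KZ.IntegralRep N) (k m k' m' : ℕ)
      (ρB : Fin k → KZ.IntegralRep N) (ρS : Fin m → KZ.IntegralRep N)
      (ρB' : Fin k' → KZ.IntegralRep N) (ρS' : Fin m' → KZ.IntegralRep N)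
      (cB : Fin k → ℤ) (cS : Fin m → ℤ) (cB' : Fin k' → ℤ) (cS' : Fin m' → ℤ),
      (∀ x ∈ r.domain, r.integrand x = 1) → (∀ x ∈ r'.domain, r'.integrand x = 1) →
      (∀ i, ∀ x ∈ (ρB i).domain, (ρB i).integrand x = 1) →
      (∀ ν, ∀ x ∈ (ρS ν).domain, (ρS ν).integrand x = 1) →
      (∀ i, ∀ x ∈ (ρB' i).domain, (ρB' i).integrand x = 1) →
      (∀ ν, ∀ x ∈ (ρS' ν).domain, (ρS' ν).integrand x = 1) →
      (∀ i, cB i ≠ 0 → GB (ρB i)) → (∀ ν, cS ν ≠ 0 → GS (ρS ν)) →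
      (∀ i, cB' i ≠ 0 → GB (ρB' i)) → (∀ ν, cS' ν ≠ 0 → GS (ρS' ν)) →
      (∀ᵐ x : Fin N → ℝ, r.domain.indicator (fun _ => (1 : ℝ)) x =
      ∑ i, (cB i : ℝ) * (ρB i).domain.indicator (fun _ => (1 : ℝ)) x +
      ∑ ν, (cS ν : ℝ) * (ρS ν).domain.indicator (fun _ => (1 : ℝ)) x) →
      (∀ᵐ x : Fin N → ℝ, r'.domain.indicator (fun _ => (1 : ℝ)) x =
      ∑ i, (cB' i : ℝ) * (ρB' i).domain.indicator (fun _ => (1 : ℝ)) x +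
      ∑ ν, (cS' ν : ℝ) * (ρS' ν).domain.indicator (fun _ => (1 : ℝ)) x) →
      r.value = r'.value → KZ.Equivalent r r') →
    (∀ (n : ℕ) (a b : Fin n → ℝ) (m : Fin n → ℕ) (c : ℝ) (p : Fin (n + 1) → ℝ),
      (∀ ι, a ι ≤ b ι) → (∀ ι, p (Fin.castSucc ι) ≠ b ι) →
      {q : Fin (n + 1) → ℝ | (∀ ι : Fin n, a ι < q (Fin.castSucc ι) ∧ q (Fin.castSucc ι) < b ι) ∧
      ∏ ι : Fin n, q (Fin.castSucc ι) ^ (m ι) < c ∧ 0 < q (Fin.last n) ∧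
      q (Fin.last n) * ∏ ι : Fin n, q (Fin.castSucc ι) < 1}.indicator (fun _ => (1 : ℝ)) p =
      ∑ S : Finset (Fin n), (-1 : ℝ) ^ S.card *
      {q : Fin (n + 1) → ℝ | (∀ ι : Fin n, (if ι ∈ S then b ι else a ι) < q (Fin.castSucc ι)) ∧
      ∏ ι : Fin n, q (Fin.castSucc ι) ^ (m ι) < c ∧ 0 < q (Fin.last n) ∧
      q (Fin.last n) * ∏ ι : Fin n, q (Fin.castSucc ι) < 1}.indicator (fun _ => (1 : ℝ)) p) →
    (∀ (p q : ℕ) (C : Set (Fin p → ℝ)) (D : Set (Fin q → ℝ))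
      (r : KZ.IntegralRep (p + 1)) (s : KZ.IntegralRep (q + 1)) (t : KZ.IntegralRep (p + q + 1)),
      Literature.ModelTheory.ExponentialFields.IsSemialgebraic ℚ C →
      Literature.ModelTheory.ExponentialFields.IsSemialgebraic ℚ D →
      (∀ x ∈ C, ∀ ι, 0 < x ι) → (∀ y ∈ D, ∀ κ, 0 < y κ) →
      r.domain = {w : Fin (p + 1) → ℝ | (fun ι : Fin p => w (Fin.castSucc ι)) ∈ C ∧
      0 < w (Fin.last p) ∧ w (Fin.last p) * ∏ ι : Fin p, w (Fin.castSucc ι) < 1} →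
      s.domain = {w : Fin (q + 1) → ℝ | (fun κ : Fin q => w (Fin.castSucc κ)) ∈ D ∧
      0 < w (Fin.last q) ∧ w (Fin.last q) * ∏ κ : Fin q, w (Fin.castSucc κ) < 1} →
      t.domain = {w : Fin (p + q + 1) → ℝ |
      (fun ι : Fin p => w (Fin.castSucc (Fin.castAdd q ι))) ∈ C ∧
      (fun κ : Fin q => w (Fin.castSucc (Fin.natAdd p κ))) ∈ D ∧
      0 < w (Fin.last (p + q)) ∧ w (Fin.last (p + q)) * ∏ j : Fin (p + q), w (Fin.castSucc j) < 1} →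
      (∀ w ∈ r.domain, r.integrand w = 1) → (∀ w ∈ s.domain, s.integrand w = 1) →
      (∀ w ∈ t.domain, t.integrand w = 1) →
      KZ.of r * KZ.of s - KZ.of t ∈ KZ.relations) →
    (∀ (N : ℕ) (G : KZ.IntegralRep N → Prop),
      (∀ (k : ℕ) (σ : Fin k → KZ.IntegralRep N) (w : Fin k → ℤ),
      (∀ j, w j ≠ 0 → G (σ j)) → ∑ j, (w j : ℝ) * (σ j).value = 0 →
      ∑ j, w j • KZ.of (σ j) ∈ KZ.relations) →
      ∀ (k : ℕ) (ρ : Fin k → KZ.IntegralRep N) (c : Fin k → ℤ),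
      (∀ i, c i ≠ 0 → ∃ (d l : ℕ) (σ : Fin l → KZ.IntegralRep N) (w : Fin l → ℤ), d ≠ 0 ∧
      (∀ j, w j ≠ 0 → G (σ j)) ∧ d • KZ.of (ρ i) - ∑ j, w j • KZ.of (σ j) ∈ KZ.relations) →
      ∑ i, (c i : ℝ) * (ρ i).value = 0 →
      ∑ i, c i • KZ.of (ρ i) ∈ KZ.relations) →
    (∀ (n : ℕ) (α β : ℝ), 0 < α → 0 < β → IsAlgebraic ℚ α → IsAlgebraic ℚ β →
      (∀ p q : ℤ, α ^ p * β ^ q = 1 → p = 0 ∧ q = 0) →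
      ∀ (r r' : KZ.IntegralRep (n + 1)) (k k' : ℕ) (ρ : Fin k → KZ.IntegralRep (n + 1))
      (ρ' : Fin k' → KZ.IntegralRep (n + 1)) (c : Fin k → ℤ) (c' : Fin k' → ℤ),
      (∀ p ∈ r.domain, r.integrand p = 1) → (∀ p ∈ r'.domain, r'.integrand p = 1) →
      (∀ i, ∀ p ∈ (ρ i).domain, (ρ i).integrand p = 1) →
      (∀ i, ∀ p ∈ (ρ' i).domain, (ρ' i).integrand p = 1) →
      (∀ i, c i ≠ 0 → ∃ (d l : ℕ) (σ : Fin l → KZ.IntegralRep (n + 1)) (w : Fin l → ℤ), d ≠ 0 ∧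
      (∀ j, w j ≠ 0 → ∃ (a : Fin n → ℝ) (u v : Fin n → ℚ),
      (∀ p ∈ (σ j).domain, (σ j).integrand p = 1) ∧ (∀ ι, 0 < a ι) ∧
      (∀ ι, IsAlgebraic ℚ (a ι)) ∧ (∀ ι, 1 < α ^ ((u ι : ℚ) : ℝ) * β ^ ((v ι : ℚ) : ℝ)) ∧
      (σ j).domain = {p : Fin (n + 1) → ℝ | (∀ ι : Fin n, a ι < p (Fin.castSucc ι) ∧
      p (Fin.castSucc ι) < a ι * (α ^ ((u ι : ℚ) : ℝ) * β ^ ((v ι : ℚ) : ℝ))) ∧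
      0 < p (Fin.last n) ∧ p (Fin.last n) * ∏ ι : Fin n, p (Fin.castSucc ι) < 1}) ∧
      d • KZ.of (ρ i) - ∑ j, w j • KZ.of (σ j) ∈ KZ.relations) →
      (∀ i, c' i ≠ 0 → ∃ (d l : ℕ) (σ : Fin l → KZ.IntegralRep (n + 1)) (w : Fin l → ℤ), d ≠ 0 ∧
      (∀ j, w j ≠ 0 → ∃ (a : Fin n → ℝ) (u v : Fin n → ℚ),
      (∀ p ∈ (σ j).domain, (σ j).integrand p = 1) ∧ (∀ ι, 0 < a ι) ∧
      (∀ ι, IsAlgebraic ℚ (a ι)) ∧ (∀ ι, 1 < α ^ ((u ι : ℚ) : ℝ) * β ^ ((v ι : ℚ) : ℝ)) ∧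
      (σ j).domain = {p : Fin (n + 1) → ℝ | (∀ ι : Fin n, a ι < p (Fin.castSucc ι) ∧
      p (Fin.castSucc ι) < a ι * (α ^ ((u ι : ℚ) : ℝ) * β ^ ((v ι : ℚ) : ℝ))) ∧
      0 < p (Fin.last n) ∧ p (Fin.last n) * ∏ ι : Fin n, p (Fin.castSucc ι) < 1}) ∧
      d • KZ.of (ρ' i) - ∑ j, w j • KZ.of (σ j) ∈ KZ.relations) →
      (∀ᵐ x : Fin (n + 1) → ℝ, r.domain.indicator (fun _ => (1 : ℝ)) x =
      ∑ i, (c i : ℝ) * (ρ i).domain.indicator (fun _ => (1 : ℝ)) x) →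
      (∀ᵐ x : Fin (n + 1) → ℝ, r'.domain.indicator (fun _ => (1 : ℝ)) x =
      ∑ i, (c' i : ℝ) * (ρ' i).domain.indicator (fun _ => (1 : ℝ)) x) →
      r.value = r'.value → KZ.Equivalent r r') →
    (∀ (n : ℕ) (α β : ℝ), 0 < α → 0 < β → IsAlgebraic ℚ α → IsAlgebraic ℚ β →
      ∀ (M : Matrix (Fin (n + 1)) (Fin (n + 1)) ℤ) (sa : Fin (n + 1) → ℝ) (sc : ℝ) (su sv : ℚ)
      (ρ : KZ.IntegralRep (n + 1 + 1)),
      M.det ≠ 0 → (∀ ι, 0 < sa ι) → (∀ ι, IsAlgebraic ℚ (sa ι)) → IsAlgebraic ℚ sc →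
      sc = (∏ ι, sa ι) * (α ^ ((su : ℚ) : ℝ) * β ^ ((sv : ℚ) : ℝ)) →
      1 < α ^ ((su : ℚ) : ℝ) * β ^ ((sv : ℚ) : ℝ) →
      ρ.domain = {p : Fin (n + 1 + 1) → ℝ | (∀ ι : Fin (n + 1), 0 < p (Fin.castSucc ι)) ∧
      (∀ k : Fin (n + 1), sa k < ∏ j : Fin (n + 1), p (Fin.castSucc j) ^ (M k j)) ∧
      ∏ k : Fin (n + 1), ∏ j : Fin (n + 1), p (Fin.castSucc j) ^ (M k j) < sc ∧
      0 < p (Fin.last (n + 1)) ∧ p (Fin.last (n + 1)) * ∏ ι : Fin (n + 1), p (Fin.castSucc ι) < 1} →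
      (∀ p ∈ ρ.domain, ρ.integrand p = 1) →
      ∃ (d l : ℕ) (σ : Fin l → KZ.IntegralRep (n + 1 + 1)) (w : Fin l → ℤ), d ≠ 0 ∧
      (∀ j, w j ≠ 0 → ∃ (a : Fin (n + 1) → ℝ) (u v : Fin (n + 1) → ℚ),
      (∀ ξ ∈ (σ j).domain, (σ j).integrand ξ = 1) ∧ (∀ ι, 0 < a ι) ∧
      (∀ ι, IsAlgebraic ℚ (a ι)) ∧ (∀ ι, 1 < α ^ ((u ι : ℚ) : ℝ) * β ^ ((v ι : ℚ) : ℝ)) ∧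
      (σ j).domain = {ξ : Fin (n + 1 + 1) → ℝ | (∀ ι : Fin (n + 1), a ι < ξ (Fin.castSucc ι) ∧
      ξ (Fin.castSucc ι) < a ι * (α ^ ((u ι : ℚ) : ℝ) * β ^ ((v ι : ℚ) : ℝ))) ∧
      0 < ξ (Fin.last (n + 1)) ∧ ξ (Fin.last (n + 1)) * ∏ ι : Fin (n + 1), ξ (Fin.castSucc ι) < 1}) ∧
      d • KZ.of ρ - ∑ j, w j • KZ.of (σ j) ∈ KZ.relations) →
    (∀ (p q : ℕ) (α β : ℝ), 0 < α → 0 < β → IsAlgebraic ℚ α → IsAlgebraic ℚ β →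
      ∀ (C : Set (Fin p → ℝ)) (D : Set (Fin q → ℝ))
      (r : KZ.IntegralRep (p + 1)) (s : KZ.IntegralRep (q + 1)) (t : KZ.IntegralRep (p + q + 1)),
      Literature.ModelTheory.ExponentialFields.IsSemialgebraic ℚ C →
      Literature.ModelTheory.ExponentialFields.IsSemialgebraic ℚ D →
      (∀ x ∈ C, ∀ ι, 0 < x ι) → (∀ y ∈ D, ∀ κ, 0 < y κ) →
      r.domain = {w : Fin (p + 1) → ℝ | (fun ι : Fin p => w (Fin.castSucc ι)) ∈ C ∧
      0 < w (Fin.last p) ∧ w (Fin.last p) * ∏ ι : Fin p, w (Fin.castSucc ι) < 1} →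
      s.domain = {w : Fin (q + 1) → ℝ | (fun κ : Fin q => w (Fin.castSucc κ)) ∈ D ∧
      0 < w (Fin.last q) ∧ w (Fin.last q) * ∏ κ : Fin q, w (Fin.castSucc κ) < 1} →
      t.domain = {w : Fin (p + q + 1) → ℝ |
      (fun ι : Fin p => w (Fin.castSucc (Fin.castAdd q ι))) ∈ C ∧
      (fun κ : Fin q => w (Fin.castSucc (Fin.natAdd p κ))) ∈ D ∧
      0 < w (Fin.last (p + q)) ∧ w (Fin.last (p + q)) * ∏ j : Fin (p + q), w (Fin.castSucc j) < 1} →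
      (∀ w ∈ r.domain, r.integrand w = 1) → (∀ w ∈ s.domain, s.integrand w = 1) →
      (∀ w ∈ t.domain, t.integrand w = 1) →
      (∃ (d l : ℕ) (σ : Fin l → KZ.IntegralRep (p + 1)) (w : Fin l → ℤ), d ≠ 0 ∧
      (∀ j, w j ≠ 0 → ∃ (a : Fin (p) → ℝ) (u v : Fin (p) → ℚ),
      (∀ ξ ∈ (σ j).domain, (σ j).integrand ξ = 1) ∧ (∀ ι, 0 < a ι) ∧
      (∀ ι, IsAlgebraic ℚ (a ι)) ∧ (∀ ι, 1 < α ^ ((u ι : ℚ) : ℝ) * β ^ ((v ι : ℚ) : ℝ)) ∧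
      (σ j).domain = {ξ : Fin (p + 1) → ℝ | (∀ ι : Fin (p), a ι < ξ (Fin.castSucc ι) ∧
      ξ (Fin.castSucc ι) < a ι * (α ^ ((u ι : ℚ) : ℝ) * β ^ ((v ι : ℚ) : ℝ))) ∧
      0 < ξ (Fin.last (p)) ∧ ξ (Fin.last (p)) * ∏ ι : Fin (p), ξ (Fin.castSucc ι) < 1}) ∧
      d • KZ.of r - ∑ j, w j • KZ.of (σ j) ∈ KZ.relations) →
      (∃ (d l : ℕ) (σ : Fin l → KZ.IntegralRep (q + 1)) (w : Fin l → ℤ), d ≠ 0 ∧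
      (∀ j, w j ≠ 0 → ∃ (a : Fin (q) → ℝ) (u v : Fin (q) → ℚ),
      (∀ ξ ∈ (σ j).domain, (σ j).integrand ξ = 1) ∧ (∀ ι, 0 < a ι) ∧
      (∀ ι, IsAlgebraic ℚ (a ι)) ∧ (∀ ι, 1 < α ^ ((u ι : ℚ) : ℝ) * β ^ ((v ι : ℚ) : ℝ)) ∧
      (σ j).domain = {ξ : Fin (q + 1) → ℝ | (∀ ι : Fin (q), a ι < ξ (Fin.castSucc ι) ∧
      ξ (Fin.castSucc ι) < a ι * (α ^ ((u ι : ℚ) : ℝ) * β ^ ((v ι : ℚ) : ℝ))) ∧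
      0 < ξ (Fin.last (q)) ∧ ξ (Fin.last (q)) * ∏ ι : Fin (q), ξ (Fin.castSucc ι) < 1}) ∧
      d • KZ.of s - ∑ j, w j • KZ.of (σ j) ∈ KZ.relations) →
      ∃ (d l : ℕ) (σ : Fin l → KZ.IntegralRep (p + q + 1)) (w : Fin l → ℤ), d ≠ 0 ∧
      (∀ j, w j ≠ 0 → ∃ (a : Fin (p + q) → ℝ) (u v : Fin (p + q) → ℚ),
      (∀ ξ ∈ (σ j).domain, (σ j).integrand ξ = 1) ∧ (∀ ι, 0 < a ι) ∧
      (∀ ι, IsAlgebraic ℚ (a ι)) ∧ (∀ ι, 1 < α ^ ((u ι : ℚ) : ℝ) * β ^ ((v ι : ℚ) : ℝ)) ∧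
      (σ j).domain = {ξ : Fin (p + q + 1) → ℝ | (∀ ι : Fin (p + q), a ι < ξ (Fin.castSucc ι) ∧
      ξ (Fin.castSucc ι) < a ι * (α ^ ((u ι : ℚ) : ℝ) * β ^ ((v ι : ℚ) : ℝ))) ∧
      0 < ξ (Fin.last (p + q)) ∧ ξ (Fin.last (p + q)) * ∏ ι : Fin (p + q), ξ (Fin.castSucc ι) < 1}) ∧
      d • KZ.of t - ∑ j, w j • KZ.of (σ j) ∈ KZ.relations) →
    (∀ (n : ℕ) (a b : Fin n → ℝ) (m : Fin n → ℕ) (c : ℝ) (r : KZ.IntegralRep (n + 1))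
      (ρ : Finset (Fin n) → KZ.IntegralRep (n + 1)),
      (∀ ι, a ι ≤ b ι) →
      r.domain = {q : Fin (n + 1) → ℝ | (∀ ι : Fin n, a ι < q (Fin.castSucc ι) ∧ q (Fin.castSucc ι) < b ι) ∧
      ∏ ι : Fin n, q (Fin.castSucc ι) ^ (m ι) < c ∧ 0 < q (Fin.last n) ∧
      q (Fin.last n) * ∏ ι : Fin n, q (Fin.castSucc ι) < 1} →
      (∀ S : Finset (Fin n), (ρ S).domain = {q : Fin (n + 1) → ℝ | (∀ ι : Fin n, (if ι ∈ S then b ι else a ι) < q (Fin.castSucc ι)) ∧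
      ∏ ι : Fin n, q (Fin.castSucc ι) ^ (m ι) < c ∧ 0 < q (Fin.last n) ∧
      q (Fin.last n) * ∏ ι : Fin n, q (Fin.castSucc ι) < 1}) →
      ∀ᵐ x : Fin (n + 1) → ℝ, r.domain.indicator (fun _ => (1 : ℝ)) x =
      ∑ S : Finset (Fin n), (((-1 : ℤ) ^ S.card : ℤ) : ℝ) * (ρ S).domain.indicator (fun _ => (1 : ℝ)) x) →
    (∀ (n : ℕ) (α β : ℝ), 0 < α → 0 < β → IsAlgebraic ℚ α → IsAlgebraic ℚ β →
      (∀ (n : ℕ) (α β : ℝ), 0 < α → 0 < β → IsAlgebraic ℚ α → IsAlgebraic ℚ β →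
      ∀ (M : Matrix (Fin (n + 1)) (Fin (n + 1)) ℤ) (sa : Fin (n + 1) → ℝ) (sc : ℝ) (su sv : ℚ)
      (ρ : KZ.IntegralRep (n + 1 + 1)),
      M.det ≠ 0 → (∀ ι, 0 < sa ι) → (∀ ι, IsAlgebraic ℚ (sa ι)) → IsAlgebraic ℚ sc →
      sc = (∏ ι, sa ι) * (α ^ ((su : ℚ) : ℝ) * β ^ ((sv : ℚ) : ℝ)) →
      1 < α ^ ((su : ℚ) : ℝ) * β ^ ((sv : ℚ) : ℝ) →
      ρ.domain = {p : Fin (n + 1 + 1) → ℝ | (∀ ι : Fin (n + 1), 0 < p (Fin.castSucc ι)) ∧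
      (∀ k : Fin (n + 1), sa k < ∏ j : Fin (n + 1), p (Fin.castSucc j) ^ (M k j)) ∧
      ∏ k : Fin (n + 1), ∏ j : Fin (n + 1), p (Fin.castSucc j) ^ (M k j) < sc ∧
      0 < p (Fin.last (n + 1)) ∧ p (Fin.last (n + 1)) * ∏ ι : Fin (n + 1), p (Fin.castSucc ι) < 1} →
      (∀ p ∈ ρ.domain, ρ.integrand p = 1) →
      ∃ (d l : ℕ) (σ : Fin l → KZ.IntegralRep (n + 1 + 1)) (w : Fin l → ℤ), d ≠ 0 ∧
      (∀ j, w j ≠ 0 → ∃ (a : Fin (n + 1) → ℝ) (u v : Fin (n + 1) → ℚ),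
      (∀ ξ ∈ (σ j).domain, (σ j).integrand ξ = 1) ∧ (∀ ι, 0 < a ι) ∧
      (∀ ι, IsAlgebraic ℚ (a ι)) ∧ (∀ ι, 1 < α ^ ((u ι : ℚ) : ℝ) * β ^ ((v ι : ℚ) : ℝ)) ∧
      (σ j).domain = {ξ : Fin (n + 1 + 1) → ℝ | (∀ ι : Fin (n + 1), a ι < ξ (Fin.castSucc ι) ∧
      ξ (Fin.castSucc ι) < a ι * (α ^ ((u ι : ℚ) : ℝ) * β ^ ((v ι : ℚ) : ℝ))) ∧
      0 < ξ (Fin.last (n + 1)) ∧ ξ (Fin.last (n + 1)) * ∏ ι : Fin (n + 1), ξ (Fin.castSucc ι) < 1}) ∧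
      d • KZ.of ρ - ∑ j, w j • KZ.of (σ j) ∈ KZ.relations) →
      ∀ (e : Fin (n + 1) → ℝ) (m : Fin (n + 1) → ℕ) (c : ℝ) (su sv : ℚ) (ρ : KZ.IntegralRep (n + 1 + 1)),
      (∀ ι, 0 < e ι) → (∀ ι, IsAlgebraic ℚ (e ι)) → (∀ ι, 0 < m ι) → IsAlgebraic ℚ c →
      c = (∏ ι, e ι ^ (m ι)) * (α ^ ((su : ℚ) : ℝ) * β ^ ((sv : ℚ) : ℝ)) →
      ρ.domain = {p : Fin (n + 1 + 1) → ℝ | (∀ ι : Fin (n + 1), e ι < p (Fin.castSucc ι)) ∧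
      ∏ ι : Fin (n + 1), p (Fin.castSucc ι) ^ (m ι) < c ∧ 0 < p (Fin.last (n + 1)) ∧
      p (Fin.last (n + 1)) * ∏ ι : Fin (n + 1), p (Fin.castSucc ι) < 1} →
      (∀ p ∈ ρ.domain, ρ.integrand p = 1) →
      ∃ (d l : ℕ) (σ : Fin l → KZ.IntegralRep (n + 1 + 1)) (w : Fin l → ℤ), d ≠ 0 ∧
      (∀ j, w j ≠ 0 → ∃ (a : Fin (n + 1) → ℝ) (u v : Fin (n + 1) → ℚ),
      (∀ ξ ∈ (σ j).domain, (σ j).integrand ξ = 1) ∧ (∀ ι, 0 < a ι) ∧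
      (∀ ι, IsAlgebraic ℚ (a ι)) ∧ (∀ ι, 1 < α ^ ((u ι : ℚ) : ℝ) * β ^ ((v ι : ℚ) : ℝ)) ∧
      (σ j).domain = {ξ : Fin (n + 1 + 1) → ℝ | (∀ ι : Fin (n + 1), a ι < ξ (Fin.castSucc ι) ∧
      ξ (Fin.castSucc ι) < a ι * (α ^ ((u ι : ℚ) : ℝ) * β ^ ((v ι : ℚ) : ℝ))) ∧
      0 < ξ (Fin.last (n + 1)) ∧ ξ (Fin.last (n + 1)) * ∏ ι : Fin (n + 1), ξ (Fin.castSucc ι) < 1}) ∧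
      d • KZ.of ρ - ∑ j, w j • KZ.of (σ j) ∈ KZ.relations) →
    (∀ (n : ℕ) (α β : ℝ), 0 < α → 0 < β → IsAlgebraic ℚ α → IsAlgebraic ℚ β →
      ∀ (M : Matrix (Fin n) (Fin n) ℤ) (a : Fin n → ℝ) (u v : Fin n → ℚ) (ρ : KZ.IntegralRep (n + 1)),
      M.det ≠ 0 → (∀ ι, 0 < a ι) → (∀ ι, IsAlgebraic ℚ (a ι)) →
      (∀ ι, 1 < α ^ ((u ι : ℚ) : ℝ) * β ^ ((v ι : ℚ) : ℝ)) →
      ρ.domain = {p : Fin (n + 1) → ℝ | (∀ ι : Fin n, 0 < p (Fin.castSucc ι)) ∧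
      (∀ k : Fin n, a k < ∏ j : Fin n, p (Fin.castSucc j) ^ (M k j) ∧
      ∏ j : Fin n, p (Fin.castSucc j) ^ (M k j) < a k * (α ^ ((u k : ℚ) : ℝ) * β ^ ((v k : ℚ) : ℝ))) ∧
      0 < p (Fin.last n) ∧ p (Fin.last n) * ∏ ι : Fin n, p (Fin.castSucc ι) < 1} →
      (∀ p ∈ ρ.domain, ρ.integrand p = 1) →
      ∃ (d l : ℕ) (σ : Fin l → KZ.IntegralRep (n + 1)) (w : Fin l → ℤ), d ≠ 0 ∧
      (∀ j, w j ≠ 0 → ∃ (a : Fin (n) → ℝ) (u v : Fin (n) → ℚ),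
      (∀ ξ ∈ (σ j).domain, (σ j).integrand ξ = 1) ∧ (∀ ι, 0 < a ι) ∧
      (∀ ι, IsAlgebraic ℚ (a ι)) ∧ (∀ ι, 1 < α ^ ((u ι : ℚ) : ℝ) * β ^ ((v ι : ℚ) : ℝ)) ∧
      (σ j).domain = {ξ : Fin (n + 1) → ℝ | (∀ ι : Fin (n), a ι < ξ (Fin.castSucc ι) ∧
      ξ (Fin.castSucc ι) < a ι * (α ^ ((u ι : ℚ) : ℝ) * β ^ ((v ι : ℚ) : ℝ))) ∧
      0 < ξ (Fin.last (n)) ∧ ξ (Fin.last (n)) * ∏ ι : Fin (n), ξ (Fin.castSucc ι) < 1}) ∧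
      d • KZ.of ρ - ∑ j, w j • KZ.of (σ j) ∈ KZ.relations) →
    (∀ (n : ℕ) (α β : ℝ), 0 < α → 0 < β → IsAlgebraic ℚ α → IsAlgebraic ℚ β →
      (∀ p q : ℤ, α ^ p * β ^ q = 1 → p = 0 ∧ q = 0) →
      ∀ (t : Fin (n + 1) → ℝ) (ua va ub vb : Fin (n + 1) → ℚ) (m : Fin (n + 1) → ℕ) (uc vc : ℚ)
      (t' : Fin (n + 1) → ℝ) (ua' va' ub' vb' : Fin (n + 1) → ℚ) (m' : Fin (n + 1) → ℕ) (uc' vc' : ℚ)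
      (r r' : KZ.IntegralRep (n + 1 + 1)),
      (∀ ι, 0 < t ι) → (∀ ι, IsAlgebraic ℚ (t ι)) → (∀ ι, 0 < m ι) →
      (∀ ι, α ^ ((ua ι : ℚ) : ℝ) * β ^ ((va ι : ℚ) : ℝ) ≤ α ^ ((ub ι : ℚ) : ℝ) * β ^ ((vb ι : ℚ) : ℝ)) →
      (∀ ι, 0 < t' ι) → (∀ ι, IsAlgebraic ℚ (t' ι)) → (∀ ι, 0 < m' ι) →
      (∀ ι, α ^ ((ua' ι : ℚ) : ℝ) * β ^ ((va' ι : ℚ) : ℝ) ≤ α ^ ((ub' ι : ℚ) : ℝ) * β ^ ((vb' ι : ℚ) : ℝ)) →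
      r.domain = {p : Fin (n + 1 + 1) → ℝ | (∀ ι : Fin (n + 1), t ι * (α ^ ((ua ι : ℚ) : ℝ) * β ^ ((va ι : ℚ) : ℝ)) < p (Fin.castSucc ι) ∧
      p (Fin.castSucc ι) < t ι * (α ^ ((ub ι : ℚ) : ℝ) * β ^ ((vb ι : ℚ) : ℝ))) ∧
      ∏ ι : Fin (n + 1), p (Fin.castSucc ι) ^ (m ι) < (∏ ι, t ι ^ (m ι)) * (α ^ ((uc : ℚ) : ℝ) * β ^ ((vc : ℚ) : ℝ)) ∧
      0 < p (Fin.last (n + 1)) ∧ p (Fin.last (n + 1)) * ∏ ι : Fin (n + 1), p (Fin.castSucc ι) < 1} →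
      r'.domain = {p : Fin (n + 1 + 1) → ℝ | (∀ ι : Fin (n + 1), t' ι * (α ^ ((ua' ι : ℚ) : ℝ) * β ^ ((va' ι : ℚ) : ℝ)) < p (Fin.castSucc ι) ∧
      p (Fin.castSucc ι) < t' ι * (α ^ ((ub' ι : ℚ) : ℝ) * β ^ ((vb' ι : ℚ) : ℝ))) ∧
      ∏ ι : Fin (n + 1), p (Fin.castSucc ι) ^ (m' ι) < (∏ ι, t' ι ^ (m' ι)) * (α ^ ((uc' : ℚ) : ℝ) * β ^ ((vc' : ℚ) : ℝ)) ∧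
      0 < p (Fin.last (n + 1)) ∧ p (Fin.last (n + 1)) * ∏ ι : Fin (n + 1), p (Fin.castSucc ι) < 1} →
      (∀ p ∈ r.domain, r.integrand p = 1) → (∀ p ∈ r'.domain, r'.integrand p = 1) →
      r.value = r'.value → KZ.Equivalent r r') →
    (∀ (X : Type) (k : ℕ) (A : Fin k → Set X) (x : X),
      (⋃ i, A i).indicator (fun _ => (1 : ℝ)) x =
      ∑ S : Finset (Fin k), (if S.Nonempty then (-1 : ℝ) ^ (S.card + 1) else 0) *
      (⋂ i ∈ S, A i).indicator (fun _ => (1 : ℝ)) x) →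
    (∀ (n : ℕ) (α β : ℝ), 0 < α → 0 < β → IsAlgebraic ℚ α → IsAlgebraic ℚ β →
      (∀ p q : ℤ, α ^ p * β ^ q = 1 → p = 0 ∧ q = 0) →
      (∀ (X : Type) (k : ℕ) (A : Fin k → Set X) (x : X),
      (⋃ i, A i).indicator (fun _ => (1 : ℝ)) x =
      ∑ S : Finset (Fin k), (if S.Nonempty then (-1 : ℝ) ^ (S.card + 1) else 0) *
      (⋂ i ∈ S, A i).indicator (fun _ => (1 : ℝ)) x) →
      ∀ (k k' : ℕ) (t : Fin n → ℝ) (pa qa pb qb : Fin k → Fin n → ℚ)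
      (pa' qa' pb' qb' : Fin k' → Fin n → ℚ) (r r' : KZ.IntegralRep (n + 1)),
      (∀ ι, 0 < t ι) → (∀ ι, IsAlgebraic ℚ (t ι)) →
      r.domain = ⋃ i : Fin k, {p : Fin (n + 1) → ℝ | (∀ ι : Fin n, t ι * (α ^ ((pa i ι : ℚ) : ℝ) * β ^ ((qa i ι : ℚ) : ℝ)) < p (Fin.castSucc ι) ∧
      p (Fin.castSucc ι) < t ι * (α ^ ((pb i ι : ℚ) : ℝ) * β ^ ((qb i ι : ℚ) : ℝ))) ∧
      0 < p (Fin.last n) ∧ p (Fin.last n) * ∏ ι : Fin n, p (Fin.castSucc ι) < 1} →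
      r'.domain = ⋃ i : Fin k', {p : Fin (n + 1) → ℝ | (∀ ι : Fin n, t ι * (α ^ ((pa' i ι : ℚ) : ℝ) * β ^ ((qa' i ι : ℚ) : ℝ)) < p (Fin.castSucc ι) ∧
      p (Fin.castSucc ι) < t ι * (α ^ ((pb' i ι : ℚ) : ℝ) * β ^ ((qb' i ι : ℚ) : ℝ))) ∧
      0 < p (Fin.last n) ∧ p (Fin.last n) * ∏ ι : Fin n, p (Fin.castSucc ι) < 1} →
      (∀ p ∈ r.domain, r.integrand p = 1) → (∀ p ∈ r'.domain, r'.integrand p = 1) →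
      r.value = r'.value → KZ.Equivalent r r') →
    (∀ (n : ℕ) (α β : ℝ), 0 < α → 0 < β → IsAlgebraic ℚ α → IsAlgebraic ℚ β →
      ∀ (M : Matrix (Fin n) (Fin n) ℤ), M.det ≠ 0 → ∀ (ρ ρ' : KZ.IntegralRep (n + 1)),
      ρ.domain ⊆ {p | ∀ ι : Fin (n), 0 < p (Fin.castSucc ι)} →
      ρ'.domain ⊆ {p | ∀ ι : Fin (n), 0 < p (Fin.castSucc ι)} →
      (∀ p : Fin (n + 1) → ℝ, (∀ ι : Fin n, 0 < p (Fin.castSucc ι)) → (p ∈ ρ.domain ↔ (Fin.snoc (fun k : Fin (n) => ∏ j : Fin (n), p (Fin.castSucc j) ^ (M k j)) (p (Fin.last (n)) * (∏ j : Fin (n), p (Fin.castSucc j)) / ∏ k : Fin (n), ∏ j : Fin (n), p (Fin.castSucc j) ^ (M k j)) : Fin ((n) + 1) → ℝ) ∈ ρ'.domain)) →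
      (∀ p ∈ ρ.domain, ρ.integrand p = 1) → (∀ p ∈ ρ'.domain, ρ'.integrand p = 1) →
      ((∃ (d l : ℕ) (σ : Fin l → KZ.IntegralRep (n + 1)) (w : Fin l → ℤ), d ≠ 0 ∧
      (∀ j, w j ≠ 0 → ∃ (a : Fin (n) → ℝ) (u v : Fin (n) → ℚ),
      (∀ ξ ∈ (σ j).domain, (σ j).integrand ξ = 1) ∧ (∀ ι, 0 < a ι) ∧
      (∀ ι, IsAlgebraic ℚ (a ι)) ∧ (∀ ι, 1 < α ^ ((u ι : ℚ) : ℝ) * β ^ ((v ι : ℚ) : ℝ)) ∧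
      (σ j).domain = {ξ : Fin (n + 1) → ℝ | (∀ ι : Fin (n), a ι < ξ (Fin.castSucc ι) ∧
      ξ (Fin.castSucc ι) < a ι * (α ^ ((u ι : ℚ) : ℝ) * β ^ ((v ι : ℚ) : ℝ))) ∧
      0 < ξ (Fin.last (n)) ∧ ξ (Fin.last (n)) * ∏ ι : Fin (n), ξ (Fin.castSucc ι) < 1}) ∧
      d • KZ.of ρ' - ∑ j, w j • KZ.of (σ j) ∈ KZ.relations) →
      ∃ (d l : ℕ) (σ : Fin l → KZ.IntegralRep (n + 1)) (w : Fin l → ℤ), d ≠ 0 ∧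
      (∀ j, w j ≠ 0 → ∃ (a : Fin (n) → ℝ) (u v : Fin (n) → ℚ),
      (∀ ξ ∈ (σ j).domain, (σ j).integrand ξ = 1) ∧ (∀ ι, 0 < a ι) ∧
      (∀ ι, IsAlgebraic ℚ (a ι)) ∧ (∀ ι, 1 < α ^ ((u ι : ℚ) : ℝ) * β ^ ((v ι : ℚ) : ℝ)) ∧
      (σ j).domain = {ξ : Fin (n + 1) → ℝ | (∀ ι : Fin (n), a ι < ξ (Fin.castSucc ι) ∧
      ξ (Fin.castSucc ι) < a ι * (α ^ ((u ι : ℚ) : ℝ) * β ^ ((v ι : ℚ) : ℝ))) ∧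
      0 < ξ (Fin.last (n)) ∧ ξ (Fin.last (n)) * ∏ ι : Fin (n), ξ (Fin.castSucc ι) < 1}) ∧
      d • KZ.of ρ - ∑ j, w j • KZ.of (σ j) ∈ KZ.relations) ∧
      ((∃ (d l : ℕ) (σ : Fin l → KZ.IntegralRep (n + 1)) (w : Fin l → ℤ), d ≠ 0 ∧
      (∀ j, w j ≠ 0 → ∃ (a : Fin (n) → ℝ) (u v : Fin (n) → ℚ),
      (∀ ξ ∈ (σ j).domain, (σ j).integrand ξ = 1) ∧ (∀ ι, 0 < a ι) ∧
      (∀ ι, IsAlgebraic ℚ (a ι)) ∧ (∀ ι, 1 < α ^ ((u ι : ℚ) : ℝ) * β ^ ((v ι : ℚ) : ℝ)) ∧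
      (σ j).domain = {ξ : Fin (n + 1) → ℝ | (∀ ι : Fin (n), a ι < ξ (Fin.castSucc ι) ∧
      ξ (Fin.castSucc ι) < a ι * (α ^ ((u ι : ℚ) : ℝ) * β ^ ((v ι : ℚ) : ℝ))) ∧
      0 < ξ (Fin.last (n)) ∧ ξ (Fin.last (n)) * ∏ ι : Fin (n), ξ (Fin.castSucc ι) < 1}) ∧
      d • KZ.of ρ - ∑ j, w j • KZ.of (σ j) ∈ KZ.relations) →
      ∃ (d l : ℕ) (σ : Fin l → KZ.IntegralRep (n + 1)) (w : Fin l → ℤ), d ≠ 0 ∧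
      (∀ j, w j ≠ 0 → ∃ (a : Fin (n) → ℝ) (u v : Fin (n) → ℚ),
      (∀ ξ ∈ (σ j).domain, (σ j).integrand ξ = 1) ∧ (∀ ι, 0 < a ι) ∧
      (∀ ι, IsAlgebraic ℚ (a ι)) ∧ (∀ ι, 1 < α ^ ((u ι : ℚ) : ℝ) * β ^ ((v ι : ℚ) : ℝ)) ∧
      (σ j).domain = {ξ : Fin (n + 1) → ℝ | (∀ ι : Fin (n), a ι < ξ (Fin.castSucc ι) ∧
      ξ (Fin.castSucc ι) < a ι * (α ^ ((u ι : ℚ) : ℝ) * β ^ ((v ι : ℚ) : ℝ))) ∧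
      0 < ξ (Fin.last (n)) ∧ ξ (Fin.last (n)) * ∏ ι : Fin (n), ξ (Fin.castSucc ι) < 1}) ∧
      d • KZ.of ρ' - ∑ j, w j • KZ.of (σ j) ∈ KZ.relations)) →
    (∀ (d k k' : ℕ) (a b : Fin k → Fin d → ℝ) (a' b' : Fin k' → Fin d → ℝ) (r r' : KZ.IntegralRep d),
      (∀ i ι, IsAlgebraic ℚ (a i ι)) → (∀ i ι, IsAlgebraic ℚ (b i ι)) →
      (∀ i ι, IsAlgebraic ℚ (a' i ι)) → (∀ i ι, IsAlgebraic ℚ (b' i ι)) →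
      r.domain = ⋃ i : Fin k, {x : Fin d → ℝ | ∀ ι, a i ι < x ι ∧ x ι < b i ι} →
      r'.domain = ⋃ i : Fin k', {x : Fin d → ℝ | ∀ ι, a' i ι < x ι ∧ x ι < b' i ι} →
      (∀ x ∈ r.domain, r.integrand x = 1) → (∀ x ∈ r'.domain, r'.integrand x = 1) →
      r.value = r'.value → KZ.Equivalent r r') →
    (∀ (d : ℕ) (a b m : Fin d → ℝ) (c : ℝ) (x : Fin d → ℝ),
      (∀ ι, a ι ≤ b ι) → (∀ ι, x ι ≠ b ι) →
      {y : Fin d → ℝ | (∀ ι, a ι < y ι ∧ y ι < b ι) ∧ ∑ ι, m ι * y ι < c}.indicator (fun _ => (1 : ℝ)) x =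
      ∑ S : Finset (Fin d), (-1 : ℝ) ^ S.card *
      {y : Fin d → ℝ | (∀ ι, (if ι ∈ S then b ι else a ι) < y ι) ∧ ∑ ι, m ι * y ι < c}.indicator
      (fun _ => (1 : ℝ)) x) →
    (∀ (d : ℕ) (a b m : Fin d → ℝ) (c : ℝ) (a' b' m' : Fin d → ℝ) (c' : ℝ) (r r' : KZ.IntegralRep d),
      (∀ ι, IsAlgebraic ℚ (a ι)) → (∀ ι, IsAlgebraic ℚ (b ι)) → (∀ ι, IsAlgebraic ℚ (m ι)) → IsAlgebraic ℚ c →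
      (∀ ι, a ι ≤ b ι) → (∀ ι, 0 < m ι) →
      (∀ ι, IsAlgebraic ℚ (a' ι)) → (∀ ι, IsAlgebraic ℚ (b' ι)) → (∀ ι, IsAlgebraic ℚ (m' ι)) → IsAlgebraic ℚ c' →
      (∀ ι, a' ι ≤ b' ι) → (∀ ι, 0 < m' ι) →
      r.domain = {x : Fin d → ℝ | (∀ ι, a ι < x ι ∧ x ι < b ι) ∧ ∑ ι, m ι * x ι < c} →
      r'.domain = {x : Fin d → ℝ | (∀ ι, a' ι < x ι ∧ x ι < b' ι) ∧ ∑ ι, m' ι * x ι < c'} →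
      (∀ x ∈ r.domain, r.integrand x = 1) → (∀ x ∈ r'.domain, r'.integrand x = 1) →
      r.value = r'.value → KZ.Equivalent r r') →
    (∀ (d : ℕ) (B : Set (Fin d → ℝ)), Literature.ModelTheory.ExponentialFields.IsSemialgebraic ℚ B → volume B ≠ ⊤ → ∀ (r r' : KZ.IntegralRep d) (k k' : ℕ) (ρ : Fin k → KZ.IntegralRep d) (ρ' : Fin k' → KZ.IntegralRep d) (c : Fin k → ℤ) (c' : Fin k' → ℤ), (∀ x ∈ r.domain, r.integrand x = 1) → (∀ x ∈ r'.domain, r'.integrand x = 1) → (∀ i, ∀ x ∈ (ρ i).domain, (ρ i).integrand x = 1) → (∀ i, ∀ x ∈ (ρ' i).domain, (ρ' i).integrand x = 1) → (∀ i, c i ≠ 0 → ∃ (A : Matrix (Fin d) (Fin d) ℝ) (b : Fin d → ℝ), (∀ j l, IsAlgebraic ℚ (A j l)) ∧ (∀ j, IsAlgebraic ℚ (b j)) ∧ A.det ≠ 0 ∧ (ρ i).domain = (fun x => A.mulVec x + b) '' B) → (∀ i, c' i ≠ 0 → ∃ (A : Matrix (Fin d) (Fin d) ℝ) (b : Fin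 d → ℝ), (∀ j l, IsAlgebraic ℚ (A j l)) ∧ (∀ j, IsAlgebraic ℚ (b j)) ∧ A.det ≠ 0 ∧ (ρ' i).domain = (fun x => A.mulVec x + b) '' B) → (∀ᵐ x : Fin d → ℝ, r.domain.indicator (fun _ => (1 : ℝ)) x = ∑ i, (c i : ℝ) * (ρ i).domain.indicator (fun _ => (1 : ℝ)) x) → (∀ᵐ x : Fin d → ℝ, r'.domain.indicator (fun _ => (1 : ℝ)) x = ∑ i, (c' i : ℝ) * (ρ' i).domain.indicator (fun _ => (1 : ℝ)) x) → r.value = r'.value → KZ.Equivalent r r') →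
    -- v7: the two-periods layer (K-cells ⊕ one transcendental body)
    (∀ (N k : ℕ) (σ : Fin k → KZ.IntegralRep N) (w : Fin k → ℤ),
      (∀ j, w j ≠ 0 → ∃ (v : ℝ) (hv : IsAlgebraic ℚ v),
        KZ.of (σ j) - KZ.of (KZ.IntegralRep.unit.constMul v hv) ∈ KZ.relations) →
      ∑ j, (w j : ℝ) * (σ j).value = 0 → ∑ j, w j • KZ.of (σ j) ∈ KZ.relations) →
    (∀ (N : ℕ) (GB GS : KZ.IntegralRep N → Prop) (ω₁ ω₂ : ℝ),
      (∀ a b : ℝ, IsAlgebraic ℚ a → IsAlgebraic ℚ b → a * ω₁ + b * ω₂ = 0 → a = 0 ∧ b = 0) →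
      (∀ ρ, GB ρ → ∃ a : ℝ, IsAlgebraic ℚ a ∧ ρ.value = a * ω₁) →
      (∀ ρ, GS ρ → ∃ b : ℝ, IsAlgebraic ℚ b ∧ ρ.value = b * ω₂) →
      (∀ (k : ℕ) (σ : Fin k → KZ.IntegralRep N) (w : Fin k → ℤ), (∀ j, w j ≠ 0 → GB (σ j)) →
        ∑ j, (w j : ℝ) * (σ j).value = 0 → ∑ j, w j • KZ.of (σ j) ∈ KZ.relations) →
      (∀ (k : ℕ) (σ : Fin k → KZ.IntegralRep N) (w : Fin k → ℤ), (∀ j, w j ≠ 0 → GS (σ j)) →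
        ∑ j, (w j : ℝ) * (σ j).value = 0 → ∑ j, w j • KZ.of (σ j) ∈ KZ.relations) →
      ∀ (k m : ℕ) (ρB : Fin k → KZ.IntegralRep N) (ρS : Fin m → KZ.IntegralRep N)
        (cB : Fin k → ℤ) (cS : Fin m → ℤ),
        (∀ i, cB i ≠ 0 → GB (ρB i)) → (∀ ν, cS ν ≠ 0 → GS (ρS ν)) →
        ∑ i, (cB i : ℝ) * (ρB i).value + ∑ ν, (cS ν : ℝ) * (ρS ν).value = 0 →
        ∑ i, cB i • KZ.of (ρB i) + ∑ ν, cS ν • KZ.of (ρS ν) ∈ KZ.relations) →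
    (∀ d : ℕ, 2 ≤ d → Transcendental ℚ (volume {z : Fin d → ℝ | ∑ i, (z i) ^ 2 < 1}).toReal) →
    (∀ (n : ℕ) (r : KZ.IntegralRep (n + 1)) (r' : KZ.IntegralRep n) (f : (Fin n → ℝ) → ℝ),
      IsSemialgebraicFunOn ℚ r'.domain f → (∀ x ∈ r'.domain, 0 ≤ f x) →
      r.domain = {z : Fin (n + 1) → ℝ | (Fin.init z : Fin n → ℝ) ∈ r'.domain ∧ 0 ≤ z (Fin.last n) ∧
        z (Fin.last n) ≤ f (Fin.init z)} →
      (∀ z ∈ r.domain, r.integrand z = 1) → (∀ x ∈ r'.domain, r'.integrand x = f x) →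
      KZ.of r - KZ.of r' ∈ KZ.relations) →
    (∀ (d : ℕ) (ρ : KZ.IntegralRep d),
      ρ.domain = {x : Fin d → ℝ | (∀ i, 0 < x i) ∧ ∑ i, x i < 1} →
      (∀ x ∈ ρ.domain, ρ.integrand x = 1) →
      ∀ hv : IsAlgebraic ℚ ((Nat.factorial d : ℝ)⁻¹),
        KZ.of ρ - KZ.of (KZ.IntegralRep.unit.constMul ((Nat.factorial d : ℝ)⁻¹) hv) ∈
          KZ.relations) →
    (∀ (d : ℕ) (a b : Fin d → ℚ) (p : MvPolynomial (Fin d) ℚ) (ρ : KZ.IntegralRep d),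
      (∀ i, a i < b i) → ρ.domain = {x : Fin d → ℝ | ∀ i, (a i : ℝ) < x i ∧ x i < (b i : ℝ)} →
      (∀ x ∈ ρ.domain, ρ.integrand x = MvPolynomial.aeval x p) →
      ∃ (v : ℝ) (hv : IsAlgebraic ℚ v),
        KZ.of ρ - KZ.of (KZ.IntegralRep.unit.constMul v hv) ∈ KZ.relations) →
    ∀ (N : ℕ), 3 ≤ N → ∀ (r r' : KZ.IntegralRep N),
    (∀ x ∈ r.domain, r.integrand x = 1) → (∀ x ∈ r'.domain, r'.integrand x = 1) →
    r.value = r'.value → KZ.Equivalent r r' := by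
  sorry

/-- **The crux by name, modulo the stubs.** Cases on the dimension: `N ≤ 1` is
`stub_dimLeOne`; `N = 2` is excluded by hypothesis; `N ≥ 3` is the conceded residual
`stub_frameHighResidual` fed with the proved toric box sector `rankTwoToricBoxes`, the toric
polygon sector `mixedPolygonSector`, the simplex / binomial sectors, the pair forms and the v6
scissors layer. -/
theorem VolumeFormOffPlane_of :
    Summit.KontsevichZagierPeriods.KontsevichZagierPeriods.Theses.SymplecticScissors.VolumeFormOffPlane := by
  intro N hN r r' hr hr' hv
  rcases Nat.lt_or_ge N 3 with h | h
  · exact stub_dimLeOne N (by omega) r r' hr hr' hv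
  · exact stub_frameHighResidual rankTwoToricBoxes mixedPolygonSector mixedSimplexSector binomialSector
      simplexPairs polygonPairs stub_scissors stub_weightedOfFamilies stub_pairsOfDecomposition
      stub_cornerCut stub_slackMerge stub_torsionClosure certifiedPairs stub_binomialCertificate
      stub_productCertificate stub_cutBoxDecomposition stub_cornerCertificate
      stub_parallelepipedCertificate stub_bevelledBoxPairs stub_indicatorInclusionExclusion
      stub_boxUnionPairs stub_monomialCertificates stub_algebraicBoxUnionPairs stub_euclideanCornerCut
      stub_algebraicBevelledBoxPairs affineOrbitPairs stub_pointCellsWeighted stub_periodSplit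
      stub_ballVolumeTranscendental stub_subgraphToBase stub_simplexCell stub_polynomialBoxCell N h r r' hr hr' hv

end Summit.KontsevichZagierPeriods.SymplecticScissors.LogPolytope

end
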